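import Mathlib
import Literature.MathematicalPhysics.QuantumFieldTheory.MagnenRivasseauSeneor1993.MRS93OneLoopCounterterms
import Literature.MathematicalPhysics.QuantumFieldTheory.MagnenRivasseauSeneor1993.MRS93AppendixFeynmanGauge
import Literature.Analysis.Potential.ArcsineHookEnergy
import HarnessLib

/-!
# Magnen–Rivasseau–Sénéor, *Construction of YM₄ with an infrared cutoff* (CMP 155, 1993), Appendix 1 — the WARM-UP
# `t = 0` (A.1)–(A.5): the angular integral `G(β)` (A.3), its printed three-branch closed form (A.4) PROVED for EVERY
# `β > 0` (classical Fourier-series / logarithmic-potential evaluation of `∫ sin²θ ln(1 − 2β cos 2θ + β²)` and of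
# `∫ sin²θ ln|1 − βκcos²θ|`), the three printed claims «G′ < 0», «G < 0», «G(β) ≤ (−4 − κ/2)β for β ≤ 1» kernel-checked,
# and the arithmetic of (A.5)

statement-level skeleton of published theorems with citation tags; proofs where landed; nothing here is a claim about the
Yang–Mills mass gap, about continuum YM₄ on T⁴, or about the Clay problem

**Citation header (reproduction of PUBLISHED work).** J. Magnen, V. Rivasseau, R. Sénéor, *Construction of YM₄ with an infrared
cutoff*, Commun. Math. Phys. **155** (1993) 325–383 [MagnenRivasseauSeneor1993], Appendix 1 pp. 378–379 [PDF 54–55]. Loci «p.NNN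
[PDF nn] tl.k» = journal page, PDF page (= journal page − 324), text-layer line of the held Project-Euclid scan
`paper:magnen1993-cmp155-mrs-ym4-infrared-cutoff` (PDF sha256 fa4ddac3…). The displays (A.1), (A.3), (A.4), (A.5) are garbled in the
text layer («G"», «4/φn)», «1 − Λ/1 − 0κ» …) and were read on 1/3-scale renders of the 600-dpi page images made with the cell's
`renders-cmp155/tools/render.py` (`run/shared/lean/pub/pub-balaban-gaps/pub-balaban-gaps-mrs-lit-2/g3/renders/p54_crop_r3300-5600_s3.png`,
`p55_crop_r600-2900_s3.png`, `p55_crop_r2800-5600_s3.png`; the 1/6-scale `p54_full_s6.png`, `p55_full_s6.png` of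
`run/shared/lean/pub/lit-balaban/inprint/lit-balaban-p14/renders-cmp155/` show the same). Cell pub-balaban-gaps (YM blitz, track G3),
seat mrs-lit-2 (gen 3); companion record `run/shared/lean/pub/pub-balaban-gaps/g3/MRS-AS-PRINTED-estimates.md` §1 row 11. Sibling
files: `MRS93AppendixFeynmanGauge.lean` ((A.2), (A.6), (A.27)–(A.29); imported for `AppendixOne.ineq_A2`), `MRS93LemmaVI2FeynmanGauge.lean`
(Lemma VI.2 at ζ = 1 by the «crude bound» route, (A.26)), `MRS93OneLoopCounterterms.lean` (imported for the two angular integrals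
`OneLoop.integral_sin_sq_zero_pi`, `OneLoop.integral_sin_sq_mul_cos_sq_zero_pi`), `MRS93AppendixA5Constants.lean` ((A.5)'s constants vs
(II.14)); tree (imported, v1.1): `Literature/Analysis/Potential/ArcsineHookEnergy.lean` (→ `ArcsineLogPotential`, `CircleLogKernel`).

**Grade of record (lit-balaban YM-INPRINT.md row D1; not this file's to change).** Appendix 1: PROOF (ζ = 1). Before this file the
tree held the two replacement inequalities (A.2)/(A.6) and (A.26)–(A.28), but none of the appendix's INTEGRAL EVALUATIONS. This file
proves the warm-up evaluation (A.3) = (A.4) — in v1 on the two open β-ranges where the integrand is smooth (§0–§3), in v1.1 (§6) on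
the remaining points and range `β = 1`, `βκ ≥ 1` (integrable logarithmic singularities) via the tree's circle and arcsine
logarithmic-potential integrals (`Literature/Analysis/Potential/CircleLogKernel.lean`, `ArcsineLogPotential.lean`,
`ArcsineHookEnergy.lean`) — and kernel-checks the consequences the appendix draws from it. An independent exact-to-1e-9 numerical
cross-check of (A.4) in all three branches is recorded in the companion record §3(h) (script
`run/shared/lean/pub/pub-balaban-gaps/pub-balaban-gaps-mrs-lit-2/g3/a4_check.py` + `a4_check.out.txt`).

**What the paper prints (verbatim; displays from the page images).**
* p.378 [PDF 54] tl.27–37 + (A.1): «In this appendix we provide some explicit bounds and computations of the determinants considered in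
  Sect. VI in the simpler case of the Feynman gauge ζ = 1. We start by a warm up: the case t = 0. The integral over φ is then trivial
  and we have to compute: `g_k(x) = exp(1/2)∫_Δ(x⁴ ∫ v dv [(4/π)∫₀^π sin²θ dθ × ln|1 − βκcos²θ| − 2 ln(1 + 2β − 4βκcos²θ + β²)] − cx⁴ +
  [x⁴ ∫ β[6 − 4κ] v dv])`. (A.1) We perform first at fixed β and κ, hence fixed v, the angular integral over θ. In order to simplify
  slightly the computation we remark first that we have the rigorous inequality (since 0 ≤ κ ≤ 1): `−2 ln(1 + 2β − 4βκcos²θ + β²) ≤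
  −2 ln(1 − 2β cos 2θ + β²)`. (A.2)» [(A.2) = `AppendixOne.ineq_A2`, sibling file.]
* p.379 [PDF 55] tl.1–2 + (A.3): «Using this inequality, we can simply compute: `G(β) = (4/π)∫₀^π sin²θ dθ ln|1 − βκcos²θ| −
  2 ln(1 − 2β cos 2θ + β²)`. (A.3)»
* p.379 tl.3–5 + (A.4): «To study G when β varies we can e.g. differentiate once again, so that the θ integration can be performed by
  elementary contour integrals. Then we integrate the result. The outcome is:
  `G(β) = −2(1 + ln 4) − 4β + 4/(βκ) + 2 ln(βκ) + 2 ln((1 + √(1 − βκ))/(1 − √(1 − βκ))) + 2/(1 + √(1 − βκ)) − 2/(1 − √(1 − βκ))`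
  if `β ≤ 1`,
  `G(β) = −2(1 + ln(4/κ)) − 6 ln β + 4(1 − κ)/(βκ) + 2 ln((1 + √(1 − βκ))/(1 − √(1 − βκ))) + 2/(1 + √(1 − βκ)) − 2/(1 − √(1 − βκ))`
  if `1 ≤ β ≤ 1/κ`,
  `G(β) = −2(1 + ln(4/κ)) − 6 ln β + 4(1 − κ)/(βκ)` if `β ≥ 1/κ`. (A.4)»
* p.379 tl.15–19: «The function G′ is always negative (remark that G′(0) = −4 − κ/2; this value is critical for the rest of our
  analysis). Therefore G is always negative (this can also be checked directly on (A.4)); moreover for β ≤ 1 we have G(β) ≤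
  (−4 − κ/2)β. Therefore, taking into account the fact that βv = κ ≤ 1, hence that β > 1 implies v < 1, and the shape of κ chosen in
  Sect. III:» [the text layer prints «G"»; the image has a single prime.]
* (A.5) p.379: «`g_k(x) ≤ exp∫_Δ(x⁴(−c + ∫_{κ≥1/2} 4βv dv + ∫_{κ<1/2} 6βv dv − ∫(4 + κ/2)βv dv + ∫_{β>1}(4 + κ/2)βv dv))`
  `≤ exp∫_Δ(x⁴(−c + 9/2 + ∫_{κ>1/2} 4βv dv + ∫_{κ<1/2} 6βv dv − ∫_{κ=1/2} (βv/4) dv))`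
  `≤ exp∫_Δ(x⁴(−c + 9/2) + x²M^{2k}(8 + 6/2 − (1/8η))) ≤ 1` (A.5) if we take the parameter η in (II.14) sufficiently small, so that
  the constant c (which diverges like |log η|) is bigger than 9/2 and such that η is smaller than 1/88; of course in (A.5) we assumed a
  cutoff with the particular shape of Fig. II.1. Many other shapes will work as well, but it seems that cutoffs which tend very slowly to
  zero spending a lot of time between 1/2 and 0 are ruled out by this method.» [«κ = 1/2» is the plateau of (II.14) on which κ ≡ 1/2,
  of length η⁻¹ in |p|M^{−ρ} — `Ansatz.cutoffFn_plateau` of `MRS93StartingAnsatz.lean`.]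

**What is typed / PROVED here (zero `sorry`, zero named facts; every `def` has a body).**
* §0 Two classical integrals, proved from Mathlib's Taylor series of the complex logarithm
  (`Complex.hasSum_taylorSeries_neg_log`) by termwise integration (dominated convergence) — private [folklore] helpers
  `hasSum_pow_mul_cos_div` (`Σ_{n≥1} rⁿcos(nφ)/n = −½ ln(1 − 2r cos φ + r²)`, `0 ≤ r < 1`), `integral_cos_nat_mul_two_pi`,
  `integral_cos_mul_cos_nat_mul_two_pi`, `integral_one_sub_cos_mul_log_quad` (`∫₀^{2π}(1 − cos x) ln(1 − 2r cos x + r²) dx = 2πr`) —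
  and, public, the `[0, π]` evaluations that (A.4) prints: **`integral_sin_sq_mul_log_quad_of_lt_one`**
  (`∫₀^π sin²θ ln(1 − 2β cos 2θ + β²) dθ = πβ/2`, `0 ≤ β < 1`), **`integral_sin_sq_mul_log_quad_of_one_lt`** (`= π ln β + π/(2β)`,
  `β > 1`, by `β ↦ 1/β`).
* §1 (A.3) as a definition `G_A3 β κ` (one `intervalIntegral` over `[0, π]`, the integrand exactly as displayed), its two halves
  `fpLogAvg u` (`u = βκ`; the Faddeev–Popov logarithm) and `bosonLogAvg β`; `A1_bracket_le_A3_integrand` = the passage (A.1) → (A.3)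
  by (A.2), pointwise.
* §2 (A.4) as definitions `G_A4_b1`, `G_A4_b2`, `G_A4_b3` (the three printed branches, verbatim) and `G_A4` (piecewise, the printed
  ranges; at the shared endpoints the branches AGREE: `G_A4_b1_eq_b2_at_one`, `G_A4_b2_eq_b3_at_inv`), with the printed grouping made
  explicit: each branch = `fpLogClosed(βκ)` (resp. `fpLogClosedLarge(βκ)`) + the boson closed form (`G_A4_b1_eq`, `G_A4_b2_eq`,
  `G_A4_b3_eq`).
* §3 THE EVALUATION: `one_sub_mul_cos_sq_factor` (`1 − u cos²θ = ((1 + s)²/4)(1 − 2ρ cos 2θ + ρ²)`, `s = √(1 − u)`,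
  `ρ = (1 − s)/(1 + s)`), **`fpLogAvg_eq_fpLogClosed`** (`0 < u < 1`), `bosonLogAvg_eq_of_lt_one` / `_of_one_lt`, and
  **`G_A3_eq_G_A4_of_lt_one`** (`0 < β < 1`, `0 < κ ≤ 1`), **`G_A3_eq_G_A4_of_one_lt`** (`1 < β`, `βκ < 1`, `0 < κ`): the printed
  closed form (A.4) IS the integral (A.3) on these ranges.
* §4 THE PRINTED CLAIMS on the ranges where the integrand is smooth: **`G_A3_le_slope`** («for β ≤ 1 we have G(β) ≤ (−4 − κ/2)β»:
  for `0 ≤ β < 1`, `0 ≤ κ ≤ 1`; via `ln(1 − z) ≤ −z` and the exact boson value — no closed form needed), `G_A3_ge_slope_sub_sq`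
  (the matching lower bound `(−4 − κ/2)β − (βκ)² ≤ G(β)` for `βκ ≤ 1/2`), hence **`tendsto_G_A3_div`** («G′(0) = −4 − κ/2» as the
  right derivative at 0: `G(β)/β → −4 − κ/2`), **`G_A3_neg`** («G is always negative»: for `β > 0`, `β ≠ 1`, `βκ < 1`),
  `G_A3_strictAntiOn_Ico` / `G_A3_strictAntiOn_gt_one` («G′ is always negative»: `G` strictly decreasing on `[0, 1)` and on
  `{1 < β, βκ < 1}`, by pointwise monotonicity of the first logarithm and the exact boson part).
* §5 (A.5), the displayed arithmetic: `A5_beta_gt_one` («βv = κ ≤ 1, hence β > 1 implies v < 1», and the correction integrand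
  `(4 + κ/2)βv ≤ 9/2`), `A5_counterterm_split` (`β[6 − 4κ] ≤ 4β` on `κ ≥ 1/2`, `≤ 6β` always), `A5_plateau_quarter` (on `κ ≥ 1/2`,
  `β ≤ 1`: `(6 − 4κ)β + (−4 − κ/2)β ≤ −β/4`, the «− βv/4» of the second line), `A5_eta_iff` (`8 + 6/2 − 1/(8η) ≤ 0 ↔ η ≤ 1/88`)
  and **`A5_lastLine_le_one`** (the last line: `exp(|Δ|(x⁴(−c + 9/2) + x²M^{2k}(8 + 6/2 − 1/(8η)))) ≤ 1` when `c ≥ 9/2`,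
  `0 < η ≤ 1/88`). [The constants «8», «6/2», «1/(8η)» themselves vs the profile (II.14): `MRS93AppendixA5Constants.lean`.]
* §6 (v1.1) THE REMAINING RANGES: `integral_sin_sq_mul_log_quad_one` (`β = 1`: `∫₀^π sin²θ ln(2 − 2cos 2θ) dθ = π/2`, from
  `∫ ln|1 − e^{iv}| = 0`, `∫ ln|1 − e^{iv}| cos v = −π`), `bosonLogAvg_one`, `ae_log_fp_eq` + `intervalIntegrable_fpIntegrand` (every
  `u > 0`), **`fpLogAvg_eq_fpLogClosedLarge`** (`u ≥ 1`: `= −2(1 + ln 4) + 2 ln u + 4/u`, from `∫ ln|x₀ − cos φ| = −2π ln 2`,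
  `∫ cos φ ln|x₀ − cos φ| = −2πx₀`, `x₀ = 2/u − 1`), `fpLogAvg_one`, and **`G_A3_eq_G_A4`**: (A.3) = (A.4) for EVERY `β > 0`
  (`0 < κ ≤ 1`); the claims on the closed/singular ranges: **`G_A3_le_slope'`** (`0 ≤ β ≤ 1`), **`G_A3_neg'`** (every `β > 0`),
  `G_A3_strictAntiOn_ge_inv` (strictly decreasing on `βκ ≥ 1`), `fpLogAvg_antitoneOn_Icc`, `G_A3_strictAntiOn_Icc` (`[0, 1]`),
  `G_A3_strictAntiOn_Icc_one_inv` (`[1, 1/κ]`) and, glued at the junctions, **`G_A3_strictAntiOn`**: «G′ is always negative» as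
  `StrictAntiOn (G · κ) (Ici 0)` for `0 < κ ≤ 1` (with `G_A3_zero : G(0) = 0` this re-proves «G is always negative»).

**Readings (declared).** (i) In (A.3) the `dθ` closes the measure: BOTH logarithms are under `(4/π)∫₀^π sin²θ dθ` (this is what (A.1)
displays and what (A.4) evaluates — e.g. its `−4β` is `−2·(4/π)·(πβ/2)`). (ii) Lean's `intervalIntegral` of a non-integrable
function is `0` and `Real.log 0 = 0`: §0–§4 (v1) work on the ranges where the integrand is CONTINUOUS on `[0, π]` (`βκ < 1`,
`β ≠ 1`); §6 (v1.1) proves the integrand interval-integrable for every `β > 0`, `κ ≥ 0` (`intervalIntegrable_fpIntegrand'`,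
`intervalIntegrable_bosonIntegrand'`), so the junk conventions never enter, and identities through the logarithms' zeros are used
only almost everywhere (`ae_log_fp_eq`). The numerical cross-check of record §3(h) (55 (κ, β) pairs, all three branches, worst
deviation 2.5e-9) is independent evidence, not an input. (iii) `κ > 0` wherever (A.4) is asserted (it contains `4/(βκ)`,
`ln(βκ)`); for `κ = 0` the first logarithm vanishes and `G(β) = −4β` / `−8 ln β − 4/β`, which §4/§6 cover. (iv) (A.5): `∫_Δ` of a θ-, p-independent quantity is `|Δ|` times it (`V ≥ 0` below); the
middle line's region bookkeeping (which v-intervals the plateau and the tail of the cutoff (II.14) occupy, producing «8», «6/2»,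
«1/8η» against `x²M^{2k}`) depends on the profile of Fig. II.1 and is NOT certified here — only the pointwise inequalities feeding it
and the final implication are.

**What is NOT claimed.** `G′` itself is not formed: «G′ < 0» is rendered as strict decrease and «G′(0) = −4 − κ/2» as the limit of
`G(β)/β`; (A.5)'s middle line;
anything at `t ≠ 0` ((A.7)–(A.26): see `MRS93AppendixHPrime.lean` for (A.7), (A.13)–(A.25) as printed and `MRS93LemmaVI2FeynmanGauge.lean`
§8 for (A.26)); Lemma VI.1 itself. Nothing here bears on
Bałaban's papers; nothing is continuum YM₄ on T⁴, nothing lifts the infrared cutoff, nothing is Clay.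
-/

noncomputable section

open Real MeasureTheory Set intervalIntegral Filter Topology

namespace Literature.MathematicalPhysics.QuantumFieldTheory.MagnenRivasseauSeneor1993

namespace AppendixOne

/-! ## §0 Two classical integrals -/

/-- The Fourier series of the logarithm of the Poisson quadratic: for `0 ≤ r < 1` and every `φ`,
`Σ_{n ≥ 1} rⁿ cos(nφ)/n = −½ ln(1 − 2r cos φ + r²)` (the `n = 0` term is `0` since `x / 0 = 0`). Real part of Mathlib's
`Complex.hasSum_taylorSeries_neg_log` at `z = r e^{iφ}`. Private helper. [folklore] -/
private theorem hasSum_pow_mul_cos_div (r φ : ℝ) (hr0 : 0 ≤ r) (hr1 : r < 1) :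
    HasSum (fun n : ℕ => r ^ n * Real.cos (n * φ) / n)
      (-(1 / 2) * Real.log (1 - 2 * r * Real.cos φ + r ^ 2)) := by
  set z : ℂ := (r : ℂ) * Complex.exp ((φ : ℂ) * Complex.I) with hz
  have hnz : ‖z‖ < 1 := by
    rw [hz, norm_mul, Complex.norm_real, Complex.norm_exp_ofReal_mul_I, mul_one, Real.norm_eq_abs,
      abs_of_nonneg hr0]
    exact hr1
  have hsum := Complex.hasSum_re (Complex.hasSum_taylorSeries_neg_log hnz)
  have hterm : ∀ n : ℕ, (z ^ n / (n : ℂ)).re = r ^ n * Real.cos (n * φ) / n := by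
    intro n
    rw [Complex.div_natCast_re, hz, mul_pow, ← Complex.ofReal_pow, ← Complex.exp_nat_mul,
      Complex.re_ofReal_mul]
    congr 2
    have : (n : ℂ) * ((φ : ℂ) * Complex.I) = ((n * φ : ℝ) : ℂ) * Complex.I := by push_cast; ring
    rw [this, Complex.exp_ofReal_mul_I_re]
  have hq : 1 - 2 * r * Real.cos φ + r ^ 2 = ‖1 - z‖ ^ 2 := by
    rw [Complex.sq_norm, Complex.normSq_apply, hz]
    simp only [Complex.sub_re, Complex.one_re, Complex.sub_im, Complex.one_im,
      Complex.re_ofReal_mul, Complex.im_ofReal_mul, Complex.exp_ofReal_mul_I_re,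
      Complex.exp_ofReal_mul_I_im]
    nlinarith [Real.sin_sq_add_cos_sq φ]
  have hval : (-Complex.log (1 - z)).re = -(1 / 2) * Real.log (1 - 2 * r * Real.cos φ + r ^ 2) := by
    rw [Complex.neg_re, Complex.log_re, hq, Real.log_pow]
    push_cast
    ring
  simpa [hterm, hval] using hsum

/-- `∫₀^{2π} cos(nx) dx = 0` for a natural number `n ≠ 0`. Private helper. [folklore] -/
private theorem integral_cos_nat_mul_two_pi (n : ℕ) (hn : n ≠ 0) :
    ∫ x in (0 : ℝ)..2 * π, Real.cos (n * x) = 0 := by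
  have hn' : (n : ℝ) ≠ 0 := by exact_mod_cast hn
  rw [intervalIntegral.integral_comp_mul_left (fun x => Real.cos x) hn', integral_cos]
  have h1 : Real.sin ((n : ℝ) * (2 * π)) = 0 := by
    have : (n : ℝ) * (2 * π) = ((2 * n : ℕ) : ℝ) * π := by push_cast; ring
    rw [this, Real.sin_nat_mul_pi]
  simp [h1]

/-- `∫₀^{2π} cos x cos(nx) dx = π` for `n = 1` and `= 0` for a natural number `n ≥ 2`
(product-to-sum `2 cos x cos nx = cos (n+1)x + cos (n−1)x`). Private helper. [folklore] -/
private theorem integral_cos_mul_cos_nat_mul_two_pi (n : ℕ) (hn : n ≠ 0) :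
    ∫ x in (0 : ℝ)..2 * π, Real.cos x * Real.cos (n * x) = if n = 1 then π else 0 := by
  have hps : ∀ x : ℝ, Real.cos x * Real.cos (n * x) =
      (Real.cos ((n + 1 : ℕ) * x) + Real.cos ((n - 1 : ℕ) * x)) / 2 := by
    intro x
    have hcast : ((n - 1 : ℕ) : ℝ) = (n : ℝ) - 1 := by
      rw [Nat.cast_sub (Nat.one_le_iff_ne_zero.mpr hn)]; simp
    rw [Real.cos_add_cos, hcast]
    push_cast
    have e1 : (((n : ℝ) + 1) * x + ((n : ℝ) - 1) * x) / 2 = n * x := by ring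
    have e2 : (((n : ℝ) + 1) * x - ((n : ℝ) - 1) * x) / 2 = x := by ring
    rw [e1, e2]; ring
  simp_rw [hps]
  rw [intervalIntegral.integral_div, intervalIntegral.integral_add]
  · rw [integral_cos_nat_mul_two_pi (n + 1) (Nat.succ_ne_zero n)]
    by_cases h1 : n = 1
    · subst h1
      norm_num
    · rw [integral_cos_nat_mul_two_pi (n - 1) (by omega)]
      simp [h1]
  · exact (Real.continuous_cos.comp (continuous_const.mul continuous_id)).intervalIntegrable _ _
  · exact (Real.continuous_cos.comp (continuous_const.mul continuous_id)).intervalIntegrable _ _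

/-- **The classical integral** behind (A.4)'s «−4β»: for `0 ≤ r < 1`,
`∫₀^{2π} (1 − cos x) ln(1 − 2r cos x + r²) dx = 2πr` — termwise integration of `hasSum_pow_mul_cos_div` (dominated convergence with
the summable majorant `2rⁿ`); only the `n = 1` mode survives. Private helper (the public forms are the `[0, π]` versions below).
[folklore] -/
private theorem integral_one_sub_cos_mul_log_quad (r : ℝ) (hr0 : 0 ≤ r) (hr1 : r < 1) :
    ∫ x in (0 : ℝ)..2 * π, (1 - Real.cos x) * Real.log (1 - 2 * r * Real.cos x + r ^ 2)
      = 2 * π * r := by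
  have hmode : ∀ n : ℕ, ∫ x in (0 : ℝ)..2 * π, (1 - Real.cos x) * (r ^ n * Real.cos (n * x) / n)
      = if n = 1 then -(π * r) else 0 := by
    intro n
    rcases Nat.eq_zero_or_pos n with rfl | hn
    · simp
    have hn' : n ≠ 0 := Nat.pos_iff_ne_zero.mp hn
    have hsplit : ∀ x : ℝ, (1 - Real.cos x) * (r ^ n * Real.cos (n * x) / n)
        = r ^ n / n * Real.cos (n * x) - r ^ n / n * (Real.cos x * Real.cos (n * x)) := by
      intro x; ring
    simp_rw [hsplit]
    rw [intervalIntegral.integral_sub, intervalIntegral.integral_const_mul,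
      intervalIntegral.integral_const_mul, integral_cos_nat_mul_two_pi n hn',
      integral_cos_mul_cos_nat_mul_two_pi n hn']
    · by_cases h1 : n = 1
      · subst h1; simp; ring
      · simp [h1]
    · exact (by fun_prop : Continuous fun x : ℝ => r ^ n / n * Real.cos (n * x)).intervalIntegrable _ _
    · exact (by fun_prop : Continuous fun x : ℝ =>
        r ^ n / n * (Real.cos x * Real.cos (n * x))).intervalIntegrable _ _
  have hbd : ∀ (n : ℕ) (x : ℝ), ‖(1 - Real.cos x) * (r ^ n * Real.cos (n * x) / n)‖ ≤ 2 * r ^ n := by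
    intro n x
    have hrn : 0 ≤ r ^ n := pow_nonneg hr0 n
    have hfac : (1 - Real.cos x) * (r ^ n * Real.cos (n * x) / n)
        = ((1 - Real.cos x) * Real.cos (n * x)) * (r ^ n / n) := by ring
    have hq : 0 ≤ r ^ n / n := by positivity
    have hq1 : r ^ n / n ≤ r ^ n := by
      rcases Nat.eq_zero_or_pos n with rfl | hn
      · simp
      · exact div_le_self hrn (by exact_mod_cast hn)
    have h1 : abs (1 - Real.cos x) ≤ 2 := by
      rw [abs_le]; constructor <;> linarith [Real.cos_le_one x, Real.neg_one_le_cos x]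
    have h2 : abs (Real.cos (n * x)) ≤ 1 := Real.abs_cos_le_one _
    have h12 : abs ((1 - Real.cos x) * Real.cos (n * x)) ≤ 2 := by
      rw [abs_mul]
      calc abs (1 - Real.cos x) * abs (Real.cos (n * x)) ≤ 2 * 1 :=
            mul_le_mul h1 h2 (abs_nonneg _) (by norm_num)
        _ = 2 := by norm_num
    rw [Real.norm_eq_abs, hfac, abs_mul, abs_of_nonneg hq]
    calc abs ((1 - Real.cos x) * Real.cos (n * x)) * (r ^ n / n) ≤ 2 * r ^ n :=
          mul_le_mul h12 hq1 hq (by norm_num)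
      _ = 2 * r ^ n := rfl
  have hsum : HasSum (fun n : ℕ => ∫ x in (0 : ℝ)..2 * π, (1 - Real.cos x) * (r ^ n * Real.cos (n * x) / n))
      (∫ x in (0 : ℝ)..2 * π,
        (1 - Real.cos x) * (-(1 / 2) * Real.log (1 - 2 * r * Real.cos x + r ^ 2))) := by
    refine intervalIntegral.hasSum_integral_of_dominated_convergence (fun n _ => 2 * r ^ n)
      (fun n => ?_) (fun n => ?_) ?_ ?_ ?_
    · exact Continuous.aestronglyMeasurable (by fun_prop)
    · exact Eventually.of_forall fun x _ => hbd n x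
    · exact Eventually.of_forall fun x _ => (summable_geometric_of_lt_one hr0 hr1).mul_left 2
    · exact intervalIntegrable_const
    · exact Eventually.of_forall fun x _ => (hasSum_pow_mul_cos_div r x hr0 hr1).mul_left _
  have hite : HasSum (fun n : ℕ => if n = 1 then -(π * r) else (0 : ℝ))
      (∫ x in (0 : ℝ)..2 * π,
        (1 - Real.cos x) * (-(1 / 2) * Real.log (1 - 2 * r * Real.cos x + r ^ 2))) := by
    simp only [hmode] at hsum
    exact hsum
  have hI := hite.unique (hasSum_ite_eq (1 : ℕ) (-(π * r)))
  have hlin : ∫ x in (0 : ℝ)..2 * π,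
        (1 - Real.cos x) * (-(1 / 2) * Real.log (1 - 2 * r * Real.cos x + r ^ 2))
      = -(1 / 2) * ∫ x in (0 : ℝ)..2 * π, (1 - Real.cos x) * Real.log (1 - 2 * r * Real.cos x + r ^ 2) := by
    rw [← intervalIntegral.integral_const_mul]
    congr 1; ext x; ring
  have hI' := hlin ▸ hI
  linarith

/-- The Poisson quadratic `1 − 2rc + r²` is positive for `r ≥ 0`, `r ≠ 1`, `c ≤ 1` (it is `(1 − r)² + 2r(1 − c)`); with
`c = cos 2θ` this is the argument of the boson logarithm of (A.3) off `β = 1`. [cite: MagnenRivasseauSeneor1993, App. 1 (A.3) p.379] -/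
theorem quad_pos_of_ne_one {r : ℝ} (hr0 : 0 ≤ r) (hr : r ≠ 1) (c : ℝ) (hc : c ≤ 1) :
    0 < 1 - 2 * r * c + r ^ 2 := by
  have h1 : 0 < (1 - r) ^ 2 := by
    have : 1 - r ≠ 0 := sub_ne_zero.mpr (Ne.symm hr)
    positivity
  nlinarith [mul_nonneg hr0 (sub_nonneg.mpr hc)]

/-- The boson logarithm of (A.3) on `[0, π]` for `0 ≤ β < 1`: `∫₀^π sin²θ ln(1 − 2β cos 2θ + β²) dθ = πβ/2` — the evaluation
printed in (A.4) as «−4β» (`= −2·(4/π)·(πβ/2)`); `sin²θ = (1 − cos 2θ)/2` and the classical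
`∫₀^{2π}(1 − cos x) ln(1 − 2β cos x + β²) dx = 2πβ` (Fourier series of the logarithm, termwise). Our proof OF the printed evaluation.
[cite: MagnenRivasseauSeneor1993, App. 1 (A.4) p.379] -/
theorem integral_sin_sq_mul_log_quad_of_lt_one (β : ℝ) (hβ0 : 0 ≤ β) (hβ1 : β < 1) :
    ∫ θ in (0 : ℝ)..π, Real.sin θ ^ 2 * Real.log (1 - 2 * β * Real.cos (2 * θ) + β ^ 2)
      = π * β / 2 := by
  have hhalf : ∀ θ : ℝ, Real.sin θ ^ 2 * Real.log (1 - 2 * β * Real.cos (2 * θ) + β ^ 2)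
      = (1 / 2) * ((fun x => (1 - Real.cos x) * Real.log (1 - 2 * β * Real.cos x + β ^ 2)) (2 * θ)) := by
    intro θ
    simp only
    rw [Real.sin_sq, Real.cos_sq θ]
    ring
  simp_rw [hhalf]
  rw [intervalIntegral.integral_const_mul,
    intervalIntegral.integral_comp_mul_left
      (fun x => (1 - Real.cos x) * Real.log (1 - 2 * β * Real.cos x + β ^ 2)) two_ne_zero,
    mul_zero, integral_one_sub_cos_mul_log_quad β hβ0 hβ1]
  simp
  ring

/-- The boson logarithm of (A.3) on `[0, π]` for `β > 1`: `∫₀^π sin²θ ln(1 − 2β cos 2θ + β²) dθ = π ln β + π/(2β)` — the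
evaluation printed in (A.4)'s second and third branches as «−6 ln β» + (the `2 ln β` inside «2 ln(βκ)»/«−2 ln(4/κ)») and the «−4/β»
inside «4(1 − κ)/(βκ)»; by `1 − 2β cos 2θ + β² = β²(1 − 2β⁻¹cos 2θ + β⁻²)` and the previous lemma at `β⁻¹`. Our proof OF the printed
evaluation. [cite: MagnenRivasseauSeneor1993, App. 1 (A.4) p.379] -/
theorem integral_sin_sq_mul_log_quad_of_one_lt (β : ℝ) (hβ1 : 1 < β) :
    ∫ θ in (0 : ℝ)..π, Real.sin θ ^ 2 * Real.log (1 - 2 * β * Real.cos (2 * θ) + β ^ 2)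
      = π * Real.log β + π / (2 * β) := by
  have hβ0 : 0 < β := by linarith
  have hs0 : 0 ≤ β⁻¹ := by positivity
  have hs1 : β⁻¹ < 1 := inv_lt_one_of_one_lt₀ hβ1
  have hpt : ∀ θ : ℝ, Real.log (1 - 2 * β * Real.cos (2 * θ) + β ^ 2)
      = 2 * Real.log β + Real.log (1 - 2 * β⁻¹ * Real.cos (2 * θ) + β⁻¹ ^ 2) := by
    intro θ
    have hq : 0 < 1 - 2 * β⁻¹ * Real.cos (2 * θ) + β⁻¹ ^ 2 :=
      quad_pos_of_ne_one hs0 (ne_of_lt hs1) _ (Real.cos_le_one _)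
    have hfac : 1 - 2 * β * Real.cos (2 * θ) + β ^ 2
        = β ^ 2 * (1 - 2 * β⁻¹ * Real.cos (2 * θ) + β⁻¹ ^ 2) := by
      field_simp
      ring
    rw [hfac, Real.log_mul (by positivity) (ne_of_gt hq), Real.log_pow]
    push_cast
    ring
  simp_rw [hpt, mul_add]
  rw [intervalIntegral.integral_add, integral_sin_sq_mul_log_quad_of_lt_one β⁻¹ hs0 hs1]
  · have h1 : ∫ θ in (0 : ℝ)..π, Real.sin θ ^ 2 * (2 * Real.log β) = π * Real.log β := by
      rw [intervalIntegral.integral_mul_const, OneLoop.integral_sin_sq_zero_pi]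
      ring
    rw [h1]
    field_simp
  · exact (by fun_prop : Continuous fun θ : ℝ => Real.sin θ ^ 2 * (2 * Real.log β)).intervalIntegrable _ _
  · apply Continuous.intervalIntegrable
    refine (by fun_prop : Continuous fun θ : ℝ => Real.sin θ ^ 2).mul ?_
    refine Continuous.log (by fun_prop) (fun θ => ne_of_gt ?_)
    exact quad_pos_of_ne_one hs0 (ne_of_lt hs1) _ (Real.cos_le_one _)

/-! ## §1 (A.3) and its two halves, as definitions -/

/-- The Faddeev–Popov half of (A.3) as a function of `u = βκ`: `(4/π)∫₀^π sin²θ ln|1 − u cos²θ| dθ`.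
[cite: MagnenRivasseauSeneor1993, App. 1 (A.3) p.379] -/
def fpLogAvg (u : ℝ) : ℝ :=
  4 / π * ∫ θ in (0 : ℝ)..π, Real.sin θ ^ 2 * Real.log |1 - u * Real.cos θ ^ 2|

/-- The boson half of (A.3) (after (A.2)): `(4/π)∫₀^π sin²θ · 2 ln(1 − 2β cos 2θ + β²) dθ` (so that `G = fpLogAvg(βκ) − bosonLogAvg β`).
[cite: MagnenRivasseauSeneor1993, App. 1 (A.3) p.379] -/
def bosonLogAvg (β : ℝ) : ℝ :=
  4 / π * ∫ θ in (0 : ℝ)..π, Real.sin θ ^ 2 * (2 * Real.log (1 - 2 * β * Real.cos (2 * θ) + β ^ 2))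

/-- **(A.3)** p.379 [PDF 55], verbatim: «Using this inequality, we can simply compute:
`G(β) = (4/π)∫₀^π sin²θ dθ ln|1 − βκcos²θ| − 2 ln(1 − 2β cos 2θ + β²)`. (A.3)» — typed as ONE interval integral over `[0, π]` of the
displayed integrand (reading (i): both logarithms under the integral), a function of `β` and of the parameter `κ` (`0 ≤ κ ≤ 1`).
[cite: MagnenRivasseauSeneor1993, App. 1 (A.3) p.379] -/
def G_A3 (β κ : ℝ) : ℝ :=
  4 / π * ∫ θ in (0 : ℝ)..π, Real.sin θ ^ 2 *
    (Real.log |1 - β * κ * Real.cos θ ^ 2| - 2 * Real.log (1 - 2 * β * Real.cos (2 * θ) + β ^ 2))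

/-- (A.1) → (A.3), pointwise: by (A.2) (`AppendixOne.ineq_A2`, sibling file) the angular integrand of (A.1),
`ln|1 − βκcos²θ| − 2 ln(1 + 2β − 4βκcos²θ + β²)`, is bounded by the integrand of (A.3), for `β ≥ 0`, `κ ≤ 1`, at every `θ` where
`1 − 2β cos 2θ + β² > 0` («Using this inequality, we can simply compute», p.379 tl.1).
[cite: MagnenRivasseauSeneor1993, App. 1 (A.1)–(A.3) pp.378–379] -/
theorem A1_bracket_le_A3_integrand {β κ θ : ℝ} (hβ : 0 ≤ β) (hκ : κ ≤ 1)
    (hpos : 0 < 1 - 2 * β * Real.cos (2 * θ) + β ^ 2) :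
    Real.log |1 - β * κ * Real.cos θ ^ 2| - 2 * Real.log (1 + 2 * β - 4 * β * κ * Real.cos θ ^ 2 + β ^ 2)
      ≤ Real.log |1 - β * κ * Real.cos θ ^ 2| - 2 * Real.log (1 - 2 * β * Real.cos (2 * θ) + β ^ 2) := by
  have h := ineq_A2 hβ hκ hpos
  linarith

/-! ## §2 (A.4), the printed closed form, as definitions -/

/-- The `κ`-grouped part of the first two branches of (A.4), as a function of `u = βκ ∈ (0, 1]`:
`−2(1 + ln 4) + 4/u + 2 ln u + 2 ln((1 + √(1 − u))/(1 − √(1 − u))) + 2/(1 + √(1 − u)) − 2/(1 − √(1 − u))`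
(= the closed form of `fpLogAvg u`, proved in §3 for `0 < u < 1`). [cite: MagnenRivasseauSeneor1993, App. 1 (A.4) p.379] -/
def fpLogClosed (u : ℝ) : ℝ :=
  -2 * (1 + Real.log 4) + 4 / u + 2 * Real.log u
    + 2 * Real.log ((1 + Real.sqrt (1 - u)) / (1 - Real.sqrt (1 - u)))
    + 2 / (1 + Real.sqrt (1 - u)) - 2 / (1 - Real.sqrt (1 - u))

/-- The `κ`-grouped part of the third branch of (A.4), `u = βκ ≥ 1`: `−2(1 + ln 4) + 2 ln u + 4/u` (= `fpLogClosed` at `u = 1`;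
its equality with `fpLogAvg u` for every `u ≥ 1` is PROVED in §6 (v1.1), `fpLogAvg_eq_fpLogClosedLarge` — this docstring said «NOT
proved here» in v1 and is updated in v1.2, referee nit N-A4stale).
[cite: MagnenRivasseauSeneor1993, App. 1 (A.4) p.379] -/
def fpLogClosedLarge (u : ℝ) : ℝ :=
  -2 * (1 + Real.log 4) + 2 * Real.log u + 4 / u

/-- **(A.4), first branch** («if β ≤ 1»), verbatim:
`G(β) = −2(1 + ln 4) − 4β + 4/(βκ) + 2 ln(βκ) + 2 ln((1 + √(1 − βκ))/(1 − √(1 − βκ))) + 2/(1 + √(1 − βκ)) − 2/(1 − √(1 − βκ))`.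
[cite: MagnenRivasseauSeneor1993, App. 1 (A.4) p.379] -/
def G_A4_b1 (β κ : ℝ) : ℝ :=
  -2 * (1 + Real.log 4) - 4 * β + 4 / (β * κ) + 2 * Real.log (β * κ)
    + 2 * Real.log ((1 + Real.sqrt (1 - β * κ)) / (1 - Real.sqrt (1 - β * κ)))
    + 2 / (1 + Real.sqrt (1 - β * κ)) - 2 / (1 - Real.sqrt (1 - β * κ))

/-- **(A.4), second branch** («if 1 ≤ β ≤ 1/κ»), verbatim:
`G(β) = −2(1 + ln(4/κ)) − 6 ln β + 4(1 − κ)/(βκ) + 2 ln((1 + √(1 − βκ))/(1 − √(1 − βκ))) + 2/(1 + √(1 − βκ)) − 2/(1 − √(1 − βκ))`.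
[cite: MagnenRivasseauSeneor1993, App. 1 (A.4) p.379] -/
def G_A4_b2 (β κ : ℝ) : ℝ :=
  -2 * (1 + Real.log (4 / κ)) - 6 * Real.log β + 4 * (1 - κ) / (β * κ)
    + 2 * Real.log ((1 + Real.sqrt (1 - β * κ)) / (1 - Real.sqrt (1 - β * κ)))
    + 2 / (1 + Real.sqrt (1 - β * κ)) - 2 / (1 - Real.sqrt (1 - β * κ))

/-- **(A.4), third branch** («if β ≥ 1/κ»), verbatim: `G(β) = −2(1 + ln(4/κ)) − 6 ln β + 4(1 − κ)/(βκ)`.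
[cite: MagnenRivasseauSeneor1993, App. 1 (A.4) p.379] -/
def G_A4_b3 (β κ : ℝ) : ℝ :=
  -2 * (1 + Real.log (4 / κ)) - 6 * Real.log β + 4 * (1 - κ) / (β * κ)

/-- **(A.4)** p.379 [PDF 55] as ONE piecewise function on the printed ranges «β ≤ 1», «1 ≤ β ≤ 1/κ», «β ≥ 1/κ» (the middle
test written `βκ ≤ 1`, which is «β ≤ 1/κ» for `κ > 0`; the branches agree at the shared endpoints: `G_A4_b1_eq_b2_at_one`,
`G_A4_b2_eq_b3_at_inv`). [cite: MagnenRivasseauSeneor1993, App. 1 (A.4) p.379] -/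
def G_A4 (β κ : ℝ) : ℝ :=
  if β ≤ 1 then G_A4_b1 β κ else if β * κ ≤ 1 then G_A4_b2 β κ else G_A4_b3 β κ

/-- The first two branches of (A.4) agree at `β = 1` (`κ > 0`). [cite: MagnenRivasseauSeneor1993, App. 1 (A.4) p.379] -/
theorem G_A4_b1_eq_b2_at_one {κ : ℝ} (hκ : 0 < κ) : G_A4_b1 1 κ = G_A4_b2 1 κ := by
  unfold G_A4_b1 G_A4_b2
  rw [Real.log_div (by norm_num) hκ.ne', Real.log_one, one_mul]
  field_simp
  ring

/-- The last two branches of (A.4) agree at `β = 1/κ` (`κ > 0`; there `√(1 − βκ) = 0`). [cite: MagnenRivasseauSeneor1993, App. 1 (A.4) p.379] -/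
theorem G_A4_b2_eq_b3_at_inv {κ : ℝ} (hκ : 0 < κ) : G_A4_b2 (1 / κ) κ = G_A4_b3 (1 / κ) κ := by
  unfold G_A4_b2 G_A4_b3
  have h : 1 - 1 / κ * κ = 0 := by field_simp; ring
  rw [h, Real.sqrt_zero]
  simp

/-- The printed grouping, branch 1: `G_A4_b1 β κ = fpLogClosed(βκ) − 4β`. [cite: MagnenRivasseauSeneor1993, App. 1 (A.4) p.379] -/
theorem G_A4_b1_eq (β κ : ℝ) : G_A4_b1 β κ = fpLogClosed (β * κ) - 4 * β := by
  unfold G_A4_b1 fpLogClosed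
  ring

/-- The printed grouping, branch 2: `G_A4_b2 β κ = fpLogClosed(βκ) − 8 ln β − 4/β` (`β, κ > 0`; `ln(4/κ) = ln 4 − ln κ`,
`ln(βκ) = ln β + ln κ`, `4(1 − κ)/(βκ) = 4/(βκ) − 4/β`). [cite: MagnenRivasseauSeneor1993, App. 1 (A.4) p.379] -/
theorem G_A4_b2_eq {β κ : ℝ} (hβ : 0 < β) (hκ : 0 < κ) :
    G_A4_b2 β κ = fpLogClosed (β * κ) - 8 * Real.log β - 4 / β := by
  unfold G_A4_b2 fpLogClosed
  rw [Real.log_div (by norm_num) hκ.ne', Real.log_mul hβ.ne' hκ.ne']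
  field_simp
  ring

/-- The printed grouping, branch 3: `G_A4_b3 β κ = fpLogClosedLarge(βκ) − 8 ln β − 4/β` (`β, κ > 0`).
[cite: MagnenRivasseauSeneor1993, App. 1 (A.4) p.379] -/
theorem G_A4_b3_eq {β κ : ℝ} (hβ : 0 < β) (hκ : 0 < κ) :
    G_A4_b3 β κ = fpLogClosedLarge (β * κ) - 8 * Real.log β - 4 / β := by
  unfold G_A4_b3 fpLogClosedLarge
  rw [Real.log_div (by norm_num) hκ.ne', Real.log_mul hβ.ne' hκ.ne']
  field_simp
  ring

/-- At `u = 1` the two `κ`-groupings coincide (`√0 = 0`). [cite: MagnenRivasseauSeneor1993, App. 1 (A.4) p.379] -/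
theorem fpLogClosed_one : fpLogClosed 1 = fpLogClosedLarge 1 := by
  unfold fpLogClosed fpLogClosedLarge
  simp

/-! ## §3 The evaluation (A.3) = (A.4) on `0 < β < 1` and on `1 < β < 1/κ` -/

/-- The factorisation behind the Faddeev–Popov logarithm for `u ≤ 1`: with `s = √(1 − u)` and `ρ = (1 − s)/(1 + s)`,
`1 − u cos²θ = ((1 + s)²/4)(1 − 2ρ cos 2θ + ρ²)` (both sides equal `1 − u/2 − (u/2)cos 2θ`) — the step that reduces the first
logarithm of (A.3) to the second. [cite: MagnenRivasseauSeneor1993, App. 1 (A.3)–(A.4) p.379] -/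
theorem one_sub_mul_cos_sq_factor (u θ : ℝ) (hu1 : u ≤ 1) :
    1 - u * Real.cos θ ^ 2 =
      (1 + Real.sqrt (1 - u)) ^ 2 / 4 *
        (1 - 2 * ((1 - Real.sqrt (1 - u)) / (1 + Real.sqrt (1 - u))) * Real.cos (2 * θ)
          + ((1 - Real.sqrt (1 - u)) / (1 + Real.sqrt (1 - u))) ^ 2) := by
  set s := Real.sqrt (1 - u) with hs
  have hs0 : 0 ≤ s := Real.sqrt_nonneg _
  have hs2 : s ^ 2 = 1 - u := by rw [hs, Real.sq_sqrt (by linarith)]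
  have h1s : (1 + s) ≠ 0 := by positivity
  have key : (1 + s) ^ 2 / 4 *
        (1 - 2 * ((1 - s) / (1 + s)) * Real.cos (2 * θ) + ((1 - s) / (1 + s)) ^ 2)
      = (2 + 2 * s ^ 2) / 4 - (1 - s ^ 2) / 2 * Real.cos (2 * θ) := by
    field_simp
    ring
  rw [key, hs2, Real.cos_sq θ]
  ring

/-- For `0 ≤ u < 1` the Faddeev–Popov argument of (A.3) is positive: `0 < 1 − u cos²θ` (`u = βκ`).
[cite: MagnenRivasseauSeneor1993, App. 1 (A.3) p.379] -/
theorem one_sub_mul_cos_sq_pos {u : ℝ} (hu0 : 0 ≤ u) (hu1 : u < 1) (θ : ℝ) :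
    0 < 1 - u * Real.cos θ ^ 2 := by
  have hc : Real.cos θ ^ 2 ≤ 1 := by
    rw [sq_le_one_iff_abs_le_one]; exact Real.abs_cos_le_one θ
  nlinarith [sq_nonneg (Real.cos θ)]

/-- Continuity on `ℝ` of the Faddeev–Popov integrand of (A.3) on the smooth range `0 ≤ u < 1` (reading (ii)).
[cite: MagnenRivasseauSeneor1993, App. 1 (A.3) p.379] -/
theorem continuous_fpIntegrand {u : ℝ} (hu0 : 0 ≤ u) (hu1 : u < 1) :
    Continuous fun θ : ℝ => Real.sin θ ^ 2 * Real.log |1 - u * Real.cos θ ^ 2| := by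
  refine (by fun_prop : Continuous fun θ : ℝ => Real.sin θ ^ 2).mul ?_
  refine Continuous.log (by fun_prop) (fun θ => ?_)
  exact (abs_pos.mpr (one_sub_mul_cos_sq_pos hu0 hu1 θ).ne').ne'

/-- Continuity on `ℝ` of the boson integrand of (A.3) off `β = 1` (`β ≥ 0`; reading (ii)).
[cite: MagnenRivasseauSeneor1993, App. 1 (A.3) p.379] -/
theorem continuous_bosonIntegrand {β : ℝ} (hβ0 : 0 ≤ β) (hβ1 : β ≠ 1) :
    Continuous fun θ : ℝ => Real.sin θ ^ 2 * (2 * Real.log (1 - 2 * β * Real.cos (2 * θ) + β ^ 2)) := by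
  refine (by fun_prop : Continuous fun θ : ℝ => Real.sin θ ^ 2).mul (continuous_const.mul ?_)
  refine Continuous.log (by fun_prop) (fun θ => ne_of_gt ?_)
  exact quad_pos_of_ne_one hβ0 hβ1 _ (Real.cos_le_one _)

/-- `G = fpLogAvg(βκ) − bosonLogAvg β` on the smooth ranges (`βκ < 1`, `β ≠ 1`; `β, κ ≥ 0`).
[cite: MagnenRivasseauSeneor1993, App. 1 (A.3) p.379] -/
theorem G_A3_eq_fp_sub_boson {β κ : ℝ} (hβ0 : 0 ≤ β) (hβ1 : β ≠ 1) (hκ0 : 0 ≤ κ) (hu : β * κ < 1) :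
    G_A3 β κ = fpLogAvg (β * κ) - bosonLogAvg β := by
  unfold G_A3 fpLogAvg bosonLogAvg
  have hsplit : ∀ θ : ℝ, Real.sin θ ^ 2 *
      (Real.log |1 - β * κ * Real.cos θ ^ 2| - 2 * Real.log (1 - 2 * β * Real.cos (2 * θ) + β ^ 2))
      = Real.sin θ ^ 2 * Real.log |1 - β * κ * Real.cos θ ^ 2|
        - Real.sin θ ^ 2 * (2 * Real.log (1 - 2 * β * Real.cos (2 * θ) + β ^ 2)) := by
    intro θ; ring
  simp_rw [hsplit]
  rw [intervalIntegral.integral_sub ((continuous_fpIntegrand (mul_nonneg hβ0 hκ0) hu).intervalIntegrable _ _)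
    ((continuous_bosonIntegrand hβ0 hβ1).intervalIntegrable _ _)]
  ring

/-- **The Faddeev–Popov half in closed form**, `0 < u < 1`: `(4/π)∫₀^π sin²θ ln|1 − u cos²θ| dθ = fpLogClosed u` — by the
factorisation `one_sub_mul_cos_sq_factor`, the classical integral at `ρ = (1 − s)/(1 + s) ∈ [0, 1)` and `ln` algebra
(`u = (1 − s)(1 + s)`). [cite: MagnenRivasseauSeneor1993, App. 1 (A.4) p.379] -/
theorem fpLogAvg_eq_fpLogClosed {u : ℝ} (hu0 : 0 < u) (hu1 : u < 1) : fpLogAvg u = fpLogClosed u := by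
  set s := Real.sqrt (1 - u) with hs
  have hs0 : 0 < s := Real.sqrt_pos.mpr (by linarith)
  have hs2 : s ^ 2 = 1 - u := by rw [hs, Real.sq_sqrt (by linarith)]
  have hs1 : s < 1 := by nlinarith
  have h1s : 0 < 1 + s := by linarith
  have h1s' : 0 < 1 - s := by linarith
  set ρ := (1 - s) / (1 + s) with hρ
  have hρ0 : 0 ≤ ρ := by rw [hρ]; positivity
  have hρ1 : ρ < 1 := by rw [hρ, div_lt_one h1s]; linarith
  have hC : 0 < (1 + s) ^ 2 / 4 := by positivity
  -- pointwise: the logarithm splits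
  have hpt : ∀ θ : ℝ, Real.sin θ ^ 2 * Real.log |1 - u * Real.cos θ ^ 2|
      = Real.sin θ ^ 2 * Real.log ((1 + s) ^ 2 / 4)
        + Real.sin θ ^ 2 * Real.log (1 - 2 * ρ * Real.cos (2 * θ) + ρ ^ 2) := by
    intro θ
    have hq : 0 < 1 - 2 * ρ * Real.cos (2 * θ) + ρ ^ 2 :=
      quad_pos_of_ne_one hρ0 (ne_of_lt hρ1) _ (Real.cos_le_one _)
    rw [abs_of_pos (one_sub_mul_cos_sq_pos hu0.le hu1 θ), one_sub_mul_cos_sq_factor u θ hu1.le,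
      ← hs, ← hρ, Real.log_mul hC.ne' hq.ne']
    ring
  have hI : ∫ θ in (0 : ℝ)..π, Real.sin θ ^ 2 * Real.log |1 - u * Real.cos θ ^ 2|
      = π / 2 * Real.log ((1 + s) ^ 2 / 4) + π * ρ / 2 := by
    simp_rw [hpt]
    rw [intervalIntegral.integral_add, intervalIntegral.integral_mul_const, OneLoop.integral_sin_sq_zero_pi,
      integral_sin_sq_mul_log_quad_of_lt_one ρ hρ0 hρ1]
    · exact (by fun_prop : Continuous fun θ : ℝ =>
        Real.sin θ ^ 2 * Real.log ((1 + s) ^ 2 / 4)).intervalIntegrable _ _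
    · apply Continuous.intervalIntegrable
      refine (by fun_prop : Continuous fun θ : ℝ => Real.sin θ ^ 2).mul ?_
      refine Continuous.log (by fun_prop) (fun θ => ne_of_gt ?_)
      exact quad_pos_of_ne_one hρ0 (ne_of_lt hρ1) _ (Real.cos_le_one _)
  unfold fpLogAvg fpLogClosed
  rw [hI, ← hs]
  -- logarithm algebra
  have hlogC : Real.log ((1 + s) ^ 2 / 4) = 2 * Real.log (1 + s) - Real.log 4 := by
    rw [Real.log_div (by positivity) (by norm_num), Real.log_pow]; push_cast; ring
  have hu_eq : u = (1 - s) * (1 + s) := by nlinarith [hs2]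
  have hlogu : Real.log u = Real.log (1 - s) + Real.log (1 + s) := by
    rw [hu_eq, Real.log_mul h1s'.ne' h1s.ne']
  have hlogq : Real.log ((1 + s) / (1 - s)) = Real.log (1 + s) - Real.log (1 - s) :=
    Real.log_div h1s.ne' h1s'.ne'
  rw [hlogC, hlogu, hlogq, hρ, hu_eq]
  field_simp
  ring

/-- The boson half in closed form, `0 ≤ β < 1`: `bosonLogAvg β = 4β` — the «−4β» of (A.4)'s first branch.
[cite: MagnenRivasseauSeneor1993, App. 1 (A.4) p.379] -/
theorem bosonLogAvg_eq_of_lt_one {β : ℝ} (hβ0 : 0 ≤ β) (hβ1 : β < 1) : bosonLogAvg β = 4 * β := by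
  unfold bosonLogAvg
  have h : ∀ θ : ℝ, Real.sin θ ^ 2 * (2 * Real.log (1 - 2 * β * Real.cos (2 * θ) + β ^ 2))
      = 2 * (Real.sin θ ^ 2 * Real.log (1 - 2 * β * Real.cos (2 * θ) + β ^ 2)) := by intro θ; ring
  simp_rw [h]
  rw [intervalIntegral.integral_const_mul, integral_sin_sq_mul_log_quad_of_lt_one β hβ0 hβ1]
  field_simp

/-- The boson half in closed form, `β > 1`: `bosonLogAvg β = 8 ln β + 4/β` — the «−6 ln β − 2 ln β» and «−4/β» hidden in (A.4)'s
second and third branches (`−2(1 + ln(4/κ)) − 6 ln β + 4(1 − κ)/(βκ) = [−2(1 + ln 4) + 2 ln(βκ) + 4/(βκ)] − 8 ln β − 4/β`).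
[cite: MagnenRivasseauSeneor1993, App. 1 (A.4) p.379] -/
theorem bosonLogAvg_eq_of_one_lt {β : ℝ} (hβ1 : 1 < β) : bosonLogAvg β = 8 * Real.log β + 4 / β := by
  unfold bosonLogAvg
  have hβ0 : 0 < β := by linarith
  have h : ∀ θ : ℝ, Real.sin θ ^ 2 * (2 * Real.log (1 - 2 * β * Real.cos (2 * θ) + β ^ 2))
      = 2 * (Real.sin θ ^ 2 * Real.log (1 - 2 * β * Real.cos (2 * θ) + β ^ 2)) := by intro θ; ring
  simp_rw [h]
  rw [intervalIntegral.integral_const_mul, integral_sin_sq_mul_log_quad_of_one_lt β hβ1]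
  field_simp
  ring

/-- **(A.3) = (A.4) on `0 < β < 1`** (`0 < κ ≤ 1`): the first printed branch is the value of the integral.
[cite: MagnenRivasseauSeneor1993, App. 1 (A.3)–(A.4) p.379] -/
theorem G_A3_eq_G_A4_of_lt_one {β κ : ℝ} (hβ0 : 0 < β) (hβ1 : β < 1) (hκ0 : 0 < κ) (hκ1 : κ ≤ 1) :
    G_A3 β κ = G_A4 β κ := by
  have hu0 : 0 < β * κ := mul_pos hβ0 hκ0
  have hu1 : β * κ < 1 := by nlinarith
  unfold G_A4
  rw [if_pos hβ1.le, G_A4_b1_eq, G_A3_eq_fp_sub_boson hβ0.le (ne_of_lt hβ1) hκ0.le hu1,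
    fpLogAvg_eq_fpLogClosed hu0 hu1, bosonLogAvg_eq_of_lt_one hβ0.le hβ1]

/-- **(A.3) = (A.4) on `1 < β < 1/κ`** (`κ > 0`): the second printed branch is the value of the integral.
[cite: MagnenRivasseauSeneor1993, App. 1 (A.3)–(A.4) p.379] -/
theorem G_A3_eq_G_A4_of_one_lt {β κ : ℝ} (hβ1 : 1 < β) (hκ0 : 0 < κ) (hu1 : β * κ < 1) :
    G_A3 β κ = G_A4 β κ := by
  have hβ0 : 0 < β := by linarith
  have hu0 : 0 < β * κ := mul_pos hβ0 hκ0
  unfold G_A4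
  rw [if_neg (not_le.mpr hβ1), if_pos hu1.le, G_A4_b2_eq hβ0 hκ0,
    G_A3_eq_fp_sub_boson hβ0.le (ne_of_gt hβ1) hκ0.le hu1, fpLogAvg_eq_fpLogClosed hu0 hu1,
    bosonLogAvg_eq_of_one_lt hβ1]
  ring

/-! ## §4 The three printed claims (p.379 tl.15–17) on the smooth ranges -/

/-- The Faddeev–Popov half is at most its first order: for `0 ≤ u < 1`, `(4/π)∫₀^π sin²θ ln|1 − u cos²θ| dθ ≤ −u/2` (`ln(1 − z) ≤ −z`
and `(4/π)∫ sin²cos² = 1/2`) — the «−κ/2» of «G′(0) = −4 − κ/2» as a one-sided bound. [cite: MagnenRivasseauSeneor1993, App. 1 p.379 tl.15–17] -/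
theorem fpLogAvg_le {u : ℝ} (hu0 : 0 ≤ u) (hu1 : u < 1) : fpLogAvg u ≤ -(u / 2) := by
  unfold fpLogAvg
  have hmono : ∫ θ in (0 : ℝ)..π, Real.sin θ ^ 2 * Real.log |1 - u * Real.cos θ ^ 2|
      ≤ ∫ θ in (0 : ℝ)..π, -u * (Real.sin θ ^ 2 * Real.cos θ ^ 2) := by
    refine intervalIntegral.integral_mono_on Real.pi_pos.le
      ((continuous_fpIntegrand hu0 hu1).intervalIntegrable _ _)
      ((by fun_prop : Continuous fun θ : ℝ =>
        -u * (Real.sin θ ^ 2 * Real.cos θ ^ 2)).intervalIntegrable _ _) (fun θ _ => ?_)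
    have hp := one_sub_mul_cos_sq_pos hu0 hu1 θ
    rw [abs_of_pos hp]
    have hl : Real.log (1 - u * Real.cos θ ^ 2) ≤ (1 - u * Real.cos θ ^ 2) - 1 := Real.log_le_sub_one_of_pos hp
    nlinarith [sq_nonneg (Real.sin θ), sq_nonneg (Real.cos θ)]
  rw [intervalIntegral.integral_const_mul, OneLoop.integral_sin_sq_mul_cos_sq_zero_pi] at hmono
  have hπ : 0 < 4 / π := by positivity
  calc 4 / π * ∫ θ in (0 : ℝ)..π, Real.sin θ ^ 2 * Real.log |1 - u * Real.cos θ ^ 2|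
      ≤ 4 / π * (-u * (π / 8)) := mul_le_mul_of_nonneg_left hmono hπ.le
    _ = -(u / 2) := by field_simp; ring

/-- … and at least `−u/2 − u²` for `0 ≤ u ≤ 1/2` (`ln(1 − z) ≥ −z/(1 − z) ≥ −z − 2z²` for `0 ≤ z ≤ 1/2`, `cos⁴ ≤ cos²`).
[cite: MagnenRivasseauSeneor1993, App. 1 p.379 tl.15–16] -/
theorem fpLogAvg_ge {u : ℝ} (hu0 : 0 ≤ u) (hu1 : u ≤ 1 / 2) : -(u / 2) - u ^ 2 ≤ fpLogAvg u := by
  unfold fpLogAvg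
  have hu1' : u < 1 := by linarith
  have hmono : ∫ θ in (0 : ℝ)..π, -(u + 2 * u ^ 2) * (Real.sin θ ^ 2 * Real.cos θ ^ 2)
      ≤ ∫ θ in (0 : ℝ)..π, Real.sin θ ^ 2 * Real.log |1 - u * Real.cos θ ^ 2| := by
    refine intervalIntegral.integral_mono_on Real.pi_pos.le
      ((by fun_prop : Continuous fun θ : ℝ =>
        -(u + 2 * u ^ 2) * (Real.sin θ ^ 2 * Real.cos θ ^ 2)).intervalIntegrable _ _)
      ((continuous_fpIntegrand hu0 hu1').intervalIntegrable _ _) (fun θ _ => ?_)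
    have hp := one_sub_mul_cos_sq_pos hu0 hu1' θ
    rw [abs_of_pos hp]
    have hc1 : Real.cos θ ^ 2 ≤ 1 := by
      rw [sq_le_one_iff_abs_le_one]; exact Real.abs_cos_le_one θ
    set z := u * Real.cos θ ^ 2 with hz
    have hz0 : 0 ≤ z := by positivity
    have hz1 : z ≤ 1 / 2 := by
      calc z ≤ u * 1 := by rw [hz]; exact mul_le_mul_of_nonneg_left hc1 hu0
        _ ≤ 1 / 2 := by linarith
    -- ln(1 − z) ≥ 1 − 1/(1 − z)
    have hl : 1 - (1 - z)⁻¹ ≤ Real.log (1 - z) := Real.one_sub_inv_le_log_of_pos hp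
    have hinv : (1 - z)⁻¹ ≤ 1 + z + 2 * z ^ 2 := by
      rw [inv_le_comm₀ hp (by positivity)]
      -- 1/(1 + z + 2z²) ≤ 1 − z  ⟸  1 ≤ (1 − z)(1 + z + 2z²) = 1 + z² − 2z³ + … : check directly
      rw [le_sub_iff_add_le, inv_eq_one_div, div_add' _ _ _ (by positivity), div_le_one (by positivity)]
      nlinarith [mul_nonneg hz0 (sq_nonneg z), mul_nonneg (sub_nonneg.mpr hz1) (sq_nonneg z)]
    have hlz : -z - 2 * z ^ 2 ≤ Real.log (1 - z) := by linarith
    -- z² = u² cos⁴ ≤ u² cos²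
    have hz2 : z ^ 2 ≤ u ^ 2 * Real.cos θ ^ 2 := by
      rw [hz, mul_pow]
      exact mul_le_mul_of_nonneg_left (by nlinarith [sq_nonneg (Real.cos θ)]) (sq_nonneg u)
    have hs2 : 0 ≤ Real.sin θ ^ 2 := sq_nonneg _
    calc -(u + 2 * u ^ 2) * (Real.sin θ ^ 2 * Real.cos θ ^ 2)
        = Real.sin θ ^ 2 * (-z - 2 * (u ^ 2 * Real.cos θ ^ 2)) := by rw [hz]; ring
      _ ≤ Real.sin θ ^ 2 * (-z - 2 * z ^ 2) := by
          apply mul_le_mul_of_nonneg_left _ hs2; linarith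
      _ ≤ Real.sin θ ^ 2 * Real.log (1 - z) := mul_le_mul_of_nonneg_left hlz hs2
  rw [intervalIntegral.integral_const_mul, OneLoop.integral_sin_sq_mul_cos_sq_zero_pi] at hmono
  have hπ : 0 < 4 / π := by positivity
  calc -(u / 2) - u ^ 2 = 4 / π * (-(u + 2 * u ^ 2) * (π / 8)) := by field_simp; ring
    _ ≤ 4 / π * ∫ θ in (0 : ℝ)..π, Real.sin θ ^ 2 * Real.log |1 - u * Real.cos θ ^ 2| :=
        mul_le_mul_of_nonneg_left hmono hπ.le

/-- **«moreover for β ≤ 1 we have G(β) ≤ (−4 − κ/2)β»** (p.379 tl.17), on `0 ≤ β < 1`, `0 ≤ κ ≤ 1` — from `ln(1 − z) ≤ −z` on the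
Faddeev–Popov half and the EXACT boson value `4β`; this is the inequality that (A.5) integrates over `β ≤ 1`.
[cite: MagnenRivasseauSeneor1993, App. 1 p.379 tl.17] -/
theorem G_A3_le_slope {β κ : ℝ} (hβ0 : 0 ≤ β) (hβ1 : β < 1) (hκ0 : 0 ≤ κ) (hκ1 : κ ≤ 1) :
    G_A3 β κ ≤ (-4 - κ / 2) * β := by
  have hu0 : 0 ≤ β * κ := mul_nonneg hβ0 hκ0
  have hu1 : β * κ < 1 := by nlinarith
  rw [G_A3_eq_fp_sub_boson hβ0 (ne_of_lt hβ1) hκ0 hu1, bosonLogAvg_eq_of_lt_one hβ0 hβ1]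
  have h := fpLogAvg_le hu0 hu1
  linarith

/-- The matching lower bound to second order: `(−4 − κ/2)β − (βκ)² ≤ G(β)` for `0 ≤ β < 1`, `0 ≤ κ`, `βκ ≤ 1/2`.
[cite: MagnenRivasseauSeneor1993, App. 1 p.379 tl.15–16] -/
theorem G_A3_ge_slope_sub_sq {β κ : ℝ} (hβ0 : 0 ≤ β) (hβ1 : β < 1) (hκ0 : 0 ≤ κ)
    (hu : β * κ ≤ 1 / 2) : (-4 - κ / 2) * β - (β * κ) ^ 2 ≤ G_A3 β κ := by
  have hu0 : 0 ≤ β * κ := mul_nonneg hβ0 hκ0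
  have hu1 : β * κ < 1 := by linarith
  rw [G_A3_eq_fp_sub_boson hβ0 (ne_of_lt hβ1) hκ0 hu1, bosonLogAvg_eq_of_lt_one hβ0 hβ1]
  have h := fpLogAvg_ge hu0 hu
  nlinarith

/-- **«G′(0) = −4 − κ/2; this value is critical for the rest of our analysis»** (p.379 tl.15–16) — as the right derivative of (A.3) at
`β = 0` (`G(0) = 0`): `G(β)/β → −4 − κ/2` as `β → 0⁺`, for `0 ≤ κ ≤ 1` (squeeze between `G_A3_le_slope` and `G_A3_ge_slope_sub_sq`).
[cite: MagnenRivasseauSeneor1993, App. 1 p.379 tl.15–16] -/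
theorem tendsto_G_A3_div {κ : ℝ} (hκ0 : 0 ≤ κ) (hκ1 : κ ≤ 1) :
    Tendsto (fun β : ℝ => G_A3 β κ / β) (𝓝[>] 0) (𝓝 (-4 - κ / 2)) := by
  have hlow : Tendsto (fun β : ℝ => -4 - κ / 2 - κ ^ 2 * β) (𝓝[>] 0) (𝓝 (-4 - κ / 2)) := by
    have : Tendsto (fun β : ℝ => -4 - κ / 2 - κ ^ 2 * β) (𝓝 0) (𝓝 (-4 - κ / 2 - κ ^ 2 * 0)) :=
      ((continuous_const.sub (continuous_const.mul continuous_id)).tendsto 0)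
    rw [mul_zero, sub_zero] at this
    exact this.mono_left nhdsWithin_le_nhds
  have hev : ∀ᶠ β : ℝ in 𝓝[>] 0, β ∈ Ioo (0 : ℝ) (1 / 2) :=
    Ioo_mem_nhdsGT (by norm_num : (0 : ℝ) < 1 / 2)
  refine tendsto_of_tendsto_of_tendsto_of_le_of_le' hlow tendsto_const_nhds ?_ ?_
  · filter_upwards [hev] with β hβ
    have hβ0 : 0 < β := hβ.1
    have hβ1 : β < 1 := by linarith [hβ.2]
    have hu : β * κ ≤ 1 / 2 := by nlinarith [hβ.2]
    have h := G_A3_ge_slope_sub_sq hβ0.le hβ1 hκ0 hu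
    rw [le_div_iff₀ hβ0]
    have hk : κ ^ 2 * β * β ≥ (β * κ) ^ 2 := by nlinarith
    nlinarith
  · filter_upwards [hev] with β hβ
    have hβ0 : 0 < β := hβ.1
    have hβ1 : β < 1 := by linarith [hβ.2]
    rw [div_le_iff₀ hβ0]
    exact G_A3_le_slope hβ0.le hβ1 hκ0 hκ1

/-- **«Therefore G is always negative»** (p.379 tl.16), on the smooth ranges: for `0 ≤ κ ≤ 1`, `β > 0`, `β ≠ 1` and `βκ < 1`,
`G(β) < 0` (for `β < 1` by `G_A3_le_slope`; for `β > 1` the Faddeev–Popov half is `≤ 0` — its argument lies in `(0, 1]` — and the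
boson half is `8 ln β + 4/β > 0`). The range `βκ ≥ 1` (interior logarithmic singularities) is covered by the closed form only
(reading (ii)). [cite: MagnenRivasseauSeneor1993, App. 1 p.379 tl.16] -/
theorem G_A3_neg {β κ : ℝ} (hκ0 : 0 ≤ κ) (hκ1 : κ ≤ 1) (hβ0 : 0 < β) (hβ1 : β ≠ 1) (hu : β * κ < 1) :
    G_A3 β κ < 0 := by
  rcases lt_or_gt_of_ne hβ1 with h | h
  · have := G_A3_le_slope hβ0.le h hκ0 hκ1
    nlinarith
  · have hu0 : 0 ≤ β * κ := by positivity
    rw [G_A3_eq_fp_sub_boson hβ0.le hβ1 hκ0 hu, bosonLogAvg_eq_of_one_lt h]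
    have h1 := fpLogAvg_le hu0 hu
    have h2 : 0 < Real.log β := Real.log_pos h
    have h3 : 0 < 4 / β := by positivity
    nlinarith

/-- The Faddeev–Popov half of (A.3) is antitone in `u` on `[0, 1)` (pointwise: `ln(1 − u cos²θ)` decreases with `u`) — the
first-logarithm part of «G′ is always negative». [cite: MagnenRivasseauSeneor1993, App. 1 p.379 tl.15] -/
theorem fpLogAvg_antitoneOn : AntitoneOn fpLogAvg (Ico 0 1) := by
  intro u hu v hv huv
  unfold fpLogAvg
  have hπ : 0 < 4 / π := by positivity
  apply mul_le_mul_of_nonneg_left _ hπ.le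
  refine intervalIntegral.integral_mono_on Real.pi_pos.le
    ((continuous_fpIntegrand hv.1 hv.2).intervalIntegrable _ _)
    ((continuous_fpIntegrand hu.1 hu.2).intervalIntegrable _ _) (fun θ _ => ?_)
  have hpu := one_sub_mul_cos_sq_pos hu.1 hu.2 θ
  have hpv := one_sub_mul_cos_sq_pos hv.1 hv.2 θ
  rw [abs_of_pos hpu, abs_of_pos hpv]
  apply mul_le_mul_of_nonneg_left _ (sq_nonneg _)
  apply Real.log_le_log hpv
  nlinarith [sq_nonneg (Real.cos θ)]

/-- **«The function G′ is always negative»** (p.379 tl.15), first range: `G` is STRICTLY DECREASING on `0 ≤ β < 1` (`0 ≤ κ ≤ 1`):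
the Faddeev–Popov half is antitone in `β` and the boson half is exactly `−4β`. [cite: MagnenRivasseauSeneor1993, App. 1 p.379 tl.15] -/
theorem G_A3_strictAntiOn_Ico {κ : ℝ} (hκ0 : 0 ≤ κ) (hκ1 : κ ≤ 1) :
    StrictAntiOn (fun β : ℝ => G_A3 β κ) (Ico 0 1) := by
  intro a ha b hb hab
  simp only
  have hua : a * κ < 1 := by nlinarith [ha.1, ha.2]
  have hub : b * κ < 1 := by nlinarith [hb.1, hb.2]
  rw [G_A3_eq_fp_sub_boson ha.1 (ne_of_lt ha.2) hκ0 hua, G_A3_eq_fp_sub_boson hb.1 (ne_of_lt hb.2) hκ0 hub,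
    bosonLogAvg_eq_of_lt_one ha.1 ha.2, bosonLogAvg_eq_of_lt_one hb.1 hb.2]
  have hmono := fpLogAvg_antitoneOn ⟨mul_nonneg ha.1 hκ0, hua⟩ ⟨mul_nonneg hb.1 hκ0, hub⟩
    (mul_le_mul_of_nonneg_right hab.le hκ0)
  linarith

/-- **«The function G′ is always negative»**, second range: `G` is STRICTLY DECREASING on `{1 < β, βκ < 1}` (`0 ≤ κ`): the
Faddeev–Popov half is antitone and the boson half `−8 ln β − 4/β` strictly decreases for `β > 1/2`
(`ln(b/a) ≥ 1 − a/b`). [cite: MagnenRivasseauSeneor1993, App. 1 p.379 tl.15] -/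
theorem G_A3_strictAntiOn_gt_one {κ : ℝ} (hκ0 : 0 ≤ κ) :
    StrictAntiOn (fun β : ℝ => G_A3 β κ) {β : ℝ | 1 < β ∧ β * κ < 1} := by
  intro a ha b hb hab
  simp only
  have ha0 : 0 < a := by linarith [ha.1]
  have hb0 : 0 < b := by linarith [hb.1]
  rw [G_A3_eq_fp_sub_boson ha0.le (ne_of_gt ha.1) hκ0 ha.2, G_A3_eq_fp_sub_boson hb0.le (ne_of_gt hb.1) hκ0 hb.2,
    bosonLogAvg_eq_of_one_lt ha.1, bosonLogAvg_eq_of_one_lt hb.1]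
  have hmono := fpLogAvg_antitoneOn ⟨mul_nonneg ha0.le hκ0, ha.2⟩ ⟨mul_nonneg hb0.le hκ0, hb.2⟩
    (mul_le_mul_of_nonneg_right hab.le hκ0)
  -- boson part strictly increasing: 8(ln b − ln a) + 4/b − 4/a > 0
  have hlog : 1 - a / b ≤ Real.log (b / a) := by
    have := Real.one_sub_inv_le_log_of_pos (show 0 < b / a by positivity)
    rwa [inv_div] at this
  rw [Real.log_div hb0.ne' ha0.ne'] at hlog
  have hdiff : 0 < 8 * (Real.log b - Real.log a) + (4 / b - 4 / a) := by
    have h1 : 1 - a / b = (b - a) / b := by field_simp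
    have h2 : 4 / b - 4 / a = -(4 * (b - a) / (a * b)) := by field_simp; ring
    have hba : 0 < b - a := by linarith
    have h3 : 8 * ((b - a) / b) - 4 * (b - a) / (a * b) = (b - a) / b * (8 - 4 / a) := by
      field_simp
    have h4 : 0 < 8 - 4 / a := by
      rw [sub_pos, div_lt_iff₀ ha0]; linarith [ha.1]
    have h5 : 0 < (b - a) / b * (8 - 4 / a) := by positivity
    nlinarith [hlog, h1, h2, h3, h5]
  linarith

/-! ## §5 (A.5): the displayed arithmetic -/

/-- «taking into account the fact that βv = κ ≤ 1, hence that β > 1 implies v < 1» (p.379 tl.17–18), and the size of the correction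
integrand of (A.5)'s first line on that region: `(4 + κ/2)βv ≤ 9/2` — whence the «9/2» of the second line (a v-interval of length
≤ 1). [cite: MagnenRivasseauSeneor1993, App. 1 (A.5) p.379] -/
theorem A5_beta_gt_one {β v κ : ℝ} (hκ0 : 0 ≤ κ) (hκ1 : κ ≤ 1) (hβv : β * v = κ) (hβ : 1 < β) :
    v < 1 ∧ (4 + κ / 2) * (β * v) ≤ 9 / 2 := by
  constructor
  · by_contra h
    have hv1 : 1 ≤ v := not_lt.mp h
    nlinarith [mul_nonneg (sub_pos.mpr hβ).le (sub_nonneg.mpr hv1)]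
  · rw [hβv]; nlinarith

/-- The counterterm bracket of (A.1) against the regions of (A.5)'s first line: `β[6 − 4κ] ≤ 4β` where `κ ≥ 1/2` and `≤ 6β` where
`κ ≥ 0` (`β ≥ 0`). [cite: MagnenRivasseauSeneor1993, App. 1 (A.1), (A.5) pp.378–379] -/
theorem A5_counterterm_split {β κ : ℝ} (hβ : 0 ≤ β) (hκ0 : 0 ≤ κ) :
    (1 / 2 ≤ κ → β * (6 - 4 * κ) ≤ 4 * β) ∧ β * (6 - 4 * κ) ≤ 6 * β := by
  constructor
  · intro hκ; nlinarith
  · nlinarith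

/-- The «− βv/4» of (A.5)'s second line: on the plateau `κ ≥ 1/2` (and `κ ≤ 1`), for `β ≥ 0` in the range `β ≤ 1` where
`G ≤ (−4 − κ/2)β` applies, counterterm plus `G` give `β(6 − 4κ) + (−4 − κ/2)β = (2 − 9κ/2)β ≤ −β/4`.
[cite: MagnenRivasseauSeneor1993, App. 1 (A.5) p.379] -/
theorem A5_plateau_quarter {β κ : ℝ} (hβ : 0 ≤ β) (hκ : 1 / 2 ≤ κ) :
    β * (6 - 4 * κ) + (-4 - κ / 2) * β ≤ -(β / 4) := by
  nlinarith

/-- The threshold of (A.5): for `η > 0`, `8 + 6/2 − 1/(8η) ≤ 0 ↔ η ≤ 1/88` («such that η is smaller than 1/88»).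
[cite: MagnenRivasseauSeneor1993, App. 1 (A.5) p.379] -/
theorem A5_eta_iff {η : ℝ} (hη : 0 < η) : 8 + 6 / 2 - 1 / (8 * η) ≤ 0 ↔ η ≤ 1 / 88 := by
  rw [sub_nonpos, le_div_iff₀ (by positivity)]
  constructor <;> intro h <;> nlinarith

/-- **(A.5), last line**: `exp(∫_Δ(x⁴(−c + 9/2) + x²M^{2k}(8 + 6/2 − (1/8η)))) ≤ 1` «if … the constant c … is bigger than 9/2 and
such that η is smaller than 1/88» — with `∫_Δ` of the constant integrand read as `|Δ|` times it (`V = |Δ| ≥ 0`, `M2k = M^{2k} ≥ 0`,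
reading (iv)). [cite: MagnenRivasseauSeneor1993, App. 1 (A.5) p.379] -/
theorem A5_lastLine_le_one {c η x M2k V : ℝ} (hc : 9 / 2 ≤ c) (hη : 0 < η) (hη' : η ≤ 1 / 88)
    (hM : 0 ≤ M2k) (hV : 0 ≤ V) :
    Real.exp (V * (x ^ 4 * (-c + 9 / 2) + x ^ 2 * M2k * (8 + 6 / 2 - 1 / (8 * η)))) ≤ 1 := by
  rw [Real.exp_le_one_iff]
  have h1 : x ^ 4 * (-c + 9 / 2) ≤ 0 :=
    mul_nonpos_of_nonneg_of_nonpos (by positivity) (by linarith)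
  have h2 : x ^ 2 * M2k * (8 + 6 / 2 - 1 / (8 * η)) ≤ 0 :=
    mul_nonpos_of_nonneg_of_nonpos (by positivity) ((A5_eta_iff hη).mpr hη')
  exact mul_nonpos_of_nonneg_of_nonpos hV (by linarith)

/-! ## §6 (v1.1) The remaining ranges `β = 1` and `βκ ≥ 1`, via the tree's circle and arcsine logarithmic potentials

The tree's `Literature/Analysis/Potential/CircleLogKernel.lean` and `ArcsineLogPotential.lean` / `ArcsineHookEnergy.lean` hold the
integrable-singularity cases of the same classical integrals: `∫_{−π}^{π} ln|1 − e^{iv}| dv = 0`, `∫ ln|1 − e^{iv}| cos v dv = −π`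
(`integral_circleLogKernel`, `integral_circleLogKernel_mul_cos`), `∫_{−π}^{π} ln|cos x − cos β| dβ = −2π ln 2` and
`∫ cos β ln|cos x − cos β| dβ = −2π cos x` (`integral_log_abs_cos_sub_cos`, `integral_cos_mul_log_abs_cos_sub_cos`), with integrability on
every interval. With them (A.4) becomes a kernel theorem for EVERY `β > 0` (`0 < κ ≤ 1`), readings (ii)–(iii) of the module docstring
notwithstanding: `G_A3_eq_G_A4`. -/

open Literature.Analysis.Potential in
/-- The boson logarithm at `β = 1`: `∫₀^π sin²θ ln(2 − 2 cos 2θ) dθ = π/2` (`ln(2 − 2cos v) = 2 ln|1 − e^{iv}|` and the two Fourier moments of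
the circle kernel) — the common value `πβ/2 = π ln β + π/(2β)` of the two branches at `β = 1`. [cite: MagnenRivasseauSeneor1993, App. 1 (A.4) p.379] -/
theorem integral_sin_sq_mul_log_quad_one :
    ∫ θ in (0 : ℝ)..π, Real.sin θ ^ 2 * Real.log (1 - 2 * 1 * Real.cos (2 * θ) + 1 ^ 2) = π / 2 := by
  have hpt : ∀ θ : ℝ, Real.sin θ ^ 2 * Real.log (1 - 2 * 1 * Real.cos (2 * θ) + 1 ^ 2)
      = (1 : ℝ) * ((fun v => (1 - Real.cos v) * circleLogKernel v) (2 * θ)) := by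
    intro θ
    simp only
    have h2 : 1 - 2 * 1 * Real.cos (2 * θ) + 1 ^ 2 = ‖1 - Complex.exp ((2 * θ : ℝ) * Complex.I)‖ ^ 2 := by
      rw [norm_one_sub_exp_sq]; ring
    rw [h2, Real.log_pow, Real.sin_sq, Real.cos_sq θ]
    unfold circleLogKernel
    push_cast
    ring
  simp_rw [hpt]
  rw [intervalIntegral.integral_const_mul,
    intervalIntegral.integral_comp_mul_left (fun v => (1 - Real.cos v) * circleLogKernel v) two_ne_zero, mul_zero]
  have hper : Function.Periodic (fun v => (1 - Real.cos v) * circleLogKernel v) (2 * π) := by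
    intro v
    simp only
    rw [Real.cos_add_two_pi, periodic_circleLogKernel v]
  have hshift := hper.intervalIntegral_add_eq 0 (-π)
  rw [zero_add, show -π + 2 * π = π by ring] at hshift
  rw [hshift]
  have hsplit : ∀ v : ℝ, (1 - Real.cos v) * circleLogKernel v = circleLogKernel v - circleLogKernel v * Real.cos v := by
    intro v; ring
  simp_rw [hsplit]
  rw [intervalIntegral.integral_sub (intervalIntegrable_circleLogKernel _ _)
      ((intervalIntegrable_circleLogKernel _ _).mul_continuousOn Real.continuous_cos.continuousOn),
    integral_circleLogKernel, integral_circleLogKernel_mul_cos]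
  simp
  ring

/-- `bosonLogAvg 1 = 4` — at `β = 1` the boson half equals both `4β` and `8 ln β + 4/β`. [cite: MagnenRivasseauSeneor1993, App. 1 (A.4) p.379] -/
theorem bosonLogAvg_one : bosonLogAvg 1 = 4 := by
  unfold bosonLogAvg
  have h : ∀ θ : ℝ, Real.sin θ ^ 2 * (2 * Real.log (1 - 2 * 1 * Real.cos (2 * θ) + 1 ^ 2))
      = 2 * (Real.sin θ ^ 2 * Real.log (1 - 2 * 1 * Real.cos (2 * θ) + 1 ^ 2)) := by intro θ; ring
  simp_rw [h]
  rw [intervalIntegral.integral_const_mul, integral_sin_sq_mul_log_quad_one]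
  field_simp

open Literature.Analysis.Potential in
/-- Integrability of the boson integrand at `β = 1` (logarithmic singularities at `θ = 0, π`).
[cite: MagnenRivasseauSeneor1993, App. 1 (A.3) p.379] -/
theorem intervalIntegrable_bosonIntegrand_one (a b : ℝ) :
    IntervalIntegrable (fun θ : ℝ => Real.sin θ ^ 2 * (2 * Real.log (1 - 2 * 1 * Real.cos (2 * θ) + 1 ^ 2))) volume a b := by
  have hpt : ∀ θ : ℝ, Real.sin θ ^ 2 * (2 * Real.log (1 - 2 * 1 * Real.cos (2 * θ) + 1 ^ 2))
      = (4 * Real.sin θ ^ 2) * circleLogKernel (2 * θ) := by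
    intro θ
    have h2 : 1 - 2 * 1 * Real.cos (2 * θ) + 1 ^ 2 = ‖1 - Complex.exp ((2 * θ : ℝ) * Complex.I)‖ ^ 2 := by
      rw [norm_one_sub_exp_sq]; ring
    rw [h2, Real.log_pow]
    unfold circleLogKernel
    push_cast
    ring
  simp_rw [hpt]
  have hℓ : IntervalIntegrable (fun θ : ℝ => circleLogKernel (2 * θ)) volume a b := by
    have := (intervalIntegrable_circleLogKernel (2 * a) (2 * b)).comp_mul_left (c := 2)
    simpa using this
  exact hℓ.continuousOn_mul (by fun_prop)

open Literature.Analysis.Potential in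
/-- For `u > 0`, a.e. in `θ`: `ln|1 − u cos²θ| = ln(u/2) + ln|x₀ − cos 2θ|` with `x₀ = 2/u − 1` (`1 − u cos²θ = (u/2)(x₀ − cos 2θ)`; off the
countable set where `cos 2θ = x₀`, on which Lean's `ln 0 = 0` breaks the identity). [cite: MagnenRivasseauSeneor1993, App. 1 (A.3)–(A.4) p.379] -/
theorem ae_log_fp_eq {u φ₀ : ℝ} (hu : 0 < u) (hx : 2 / u - 1 = Real.cos φ₀) :
    ∀ᵐ θ : ℝ, Real.log |1 - u * Real.cos θ ^ 2| = Real.log (u / 2) + Real.log |Real.cos φ₀ - Real.cos (2 * θ)| := by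
  have hc : {θ : ℝ | Real.cos (2 * θ) = Real.cos φ₀}.Countable := by
    have h := (countable_setOf_cos_eq φ₀).image (fun β => β / 2)
    refine h.mono fun θ hθ => (Set.mem_image _ _ _).mpr ⟨2 * θ, hθ, by ring⟩
  filter_upwards [hc.ae_notMem volume] with θ hθ
  have hne : Real.cos φ₀ - Real.cos (2 * θ) ≠ 0 := by
    intro h; exact hθ (show Real.cos (2 * θ) = Real.cos φ₀ by linarith)
  have hfac : 1 - u * Real.cos θ ^ 2 = (u / 2) * (Real.cos φ₀ - Real.cos (2 * θ)) := by
    rw [← hx, Real.cos_sq θ]; field_simp; ring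
  rw [hfac, abs_mul, abs_of_pos (by positivity), Real.log_mul (by positivity) (abs_ne_zero.mpr hne)]

open Literature.Analysis.Potential in
/-- Integrability of the Faddeev–Popov integrand for every `u > 0` (for `u ≥ 1` the logarithm has integrable interior singularities at
`cos²θ = 1/u`). [cite: MagnenRivasseauSeneor1993, App. 1 (A.3) p.379] -/
theorem intervalIntegrable_fpIntegrand {u : ℝ} (hu : 0 < u) (hx : |2 / u - 1| ≤ 1) :
    IntervalIntegrable (fun θ : ℝ => Real.sin θ ^ 2 * Real.log |1 - u * Real.cos θ ^ 2|) volume 0 π := by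
  obtain ⟨φ₀, hφ₀⟩ := exists_eq_mul_cos one_pos hx
  rw [one_mul] at hφ₀
  have hℓ : IntervalIntegrable (fun θ : ℝ => Real.log |Real.cos φ₀ - Real.cos (2 * θ)|) volume 0 π := by
    have := (intervalIntegrable_log_abs_cos_sub_cos φ₀ (2 * 0) (2 * π)).comp_mul_left (c := 2)
    simpa using this
  have hrhs : IntervalIntegrable
      (fun θ : ℝ => Real.sin θ ^ 2 * (Real.log (u / 2) + Real.log |Real.cos φ₀ - Real.cos (2 * θ)|)) volume 0 π :=
    (intervalIntegrable_const.add hℓ).continuousOn_mul (by fun_prop)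
  refine hrhs.congr_ae (ae_restrict_of_ae ?_)
  filter_upwards [ae_log_fp_eq hu hφ₀] with θ hθ
  rw [hθ]

open Literature.Analysis.Potential in
/-- **The Faddeev–Popov half in closed form on `u ≥ 1`** (the third-branch grouping): `(4/π)∫₀^π sin²θ ln|1 − u cos²θ| dθ = −2(1 + ln 4) +
2 ln u + 4/u`, from `ln|1 − u cos²θ| = ln(u/2) + ln|x₀ − cos 2θ|`, `x₀ = 2/u − 1 ∈ [−1, 1]`, and the arcsine-potential moments
`∫_{−π}^{π} ln|x₀ − cos φ| dφ = −2π ln 2`, `∫ cos φ ln|x₀ − cos φ| dφ = −2πx₀`. [cite: MagnenRivasseauSeneor1993, App. 1 (A.4) p.379] -/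
theorem fpLogAvg_eq_fpLogClosedLarge {u : ℝ} (hu : 1 ≤ u) : fpLogAvg u = fpLogClosedLarge u := by
  have hu0 : 0 < u := by linarith
  have hx : |2 / u - 1| ≤ 1 := by
    rw [abs_le]
    constructor
    · have : 0 < 2 / u := by positivity
      linarith
    · rw [div_sub_one hu0.ne', div_le_one hu0]; linarith
  obtain ⟨φ₀, hφ₀⟩ := exists_eq_mul_cos one_pos hx
  rw [one_mul] at hφ₀
  -- the two moments on [−π, π], moved to [0, π] in the variable 2θ
  set m : ℝ → ℝ := fun v => (1 - Real.cos v) * Real.log |Real.cos φ₀ - Real.cos v| with hm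
  have hper : Function.Periodic m (2 * π) := by
    intro v; simp only [hm]; rw [Real.cos_add_two_pi]
  have hmint : ∫ v in (-π)..π, m v = -2 * π * Real.log 2 + 2 * π * Real.cos φ₀ := by
    have hsplit : ∀ v, m v = Real.log |Real.cos φ₀ - Real.cos v| - Real.cos v * Real.log |Real.cos φ₀ - Real.cos v| := by
      intro v; simp only [hm]; ring
    simp_rw [hsplit]
    rw [intervalIntegral.integral_sub (intervalIntegrable_log_abs_cos_sub_cos φ₀ _ _)
        ((intervalIntegrable_log_abs_cos_sub_cos φ₀ _ _).continuousOn_mul Real.continuous_cos.continuousOn),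
      integral_log_abs_cos_sub_cos, integral_cos_mul_log_abs_cos_sub_cos]
    ring
  have hI2 : ∫ θ in (0 : ℝ)..π, Real.sin θ ^ 2 * Real.log |Real.cos φ₀ - Real.cos (2 * θ)|
      = -(π / 2) * Real.log 2 + π / 2 * Real.cos φ₀ := by
    have hpt : ∀ θ : ℝ, Real.sin θ ^ 2 * Real.log |Real.cos φ₀ - Real.cos (2 * θ)| = (1 / 2 : ℝ) * m (2 * θ) := by
      intro θ; simp only [hm]; rw [Real.sin_sq, Real.cos_sq θ]; ring
    simp_rw [hpt]
    rw [intervalIntegral.integral_const_mul, intervalIntegral.integral_comp_mul_left m two_ne_zero, mul_zero]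
    have hshift := hper.intervalIntegral_add_eq 0 (-π)
    rw [zero_add, show -π + 2 * π = π by ring] at hshift
    rw [hshift, hmint]
    simp
    ring
  -- assemble
  have hI : ∫ θ in (0 : ℝ)..π, Real.sin θ ^ 2 * Real.log |1 - u * Real.cos θ ^ 2|
      = π / 2 * Real.log (u / 2) + (-(π / 2) * Real.log 2 + π / 2 * Real.cos φ₀) := by
    have hae : ∀ᵐ θ : ℝ, θ ∈ Set.uIoc (0 : ℝ) π → Real.sin θ ^ 2 * Real.log |1 - u * Real.cos θ ^ 2|
        = Real.sin θ ^ 2 * Real.log (u / 2) + Real.sin θ ^ 2 * Real.log |Real.cos φ₀ - Real.cos (2 * θ)| := by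
      filter_upwards [ae_log_fp_eq hu0 hφ₀] with θ hθ _
      rw [hθ]; ring
    have hℓ : IntervalIntegrable (fun θ : ℝ => Real.sin θ ^ 2 * Real.log |Real.cos φ₀ - Real.cos (2 * θ)|) volume 0 π := by
      have h1 : IntervalIntegrable (fun θ : ℝ => Real.log |Real.cos φ₀ - Real.cos (2 * θ)|) volume 0 π := by
        have := (intervalIntegrable_log_abs_cos_sub_cos φ₀ (2 * 0) (2 * π)).comp_mul_left (c := 2)
        simpa using this
      exact h1.continuousOn_mul (by fun_prop)
    rw [intervalIntegral.integral_congr_ae hae,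
      intervalIntegral.integral_add ((by fun_prop : Continuous fun θ : ℝ =>
        Real.sin θ ^ 2 * Real.log (u / 2)).intervalIntegrable _ _) hℓ,
      intervalIntegral.integral_mul_const, OneLoop.integral_sin_sq_zero_pi, hI2]
  unfold fpLogAvg fpLogClosedLarge
  rw [hI, ← hφ₀, Real.log_div hu0.ne' two_ne_zero, show (4 : ℝ) = 2 ^ 2 by norm_num, Real.log_pow]
  field_simp
  ring

/-- At `u = 1` both groupings give the integral: `fpLogAvg 1 = fpLogClosed 1` (`= 2 − 2 ln 4`). [cite: MagnenRivasseauSeneor1993, App. 1 (A.4) p.379] -/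
theorem fpLogAvg_one : fpLogAvg 1 = fpLogClosed 1 := by
  rw [fpLogClosed_one, fpLogAvg_eq_fpLogClosedLarge le_rfl]

/-- `G = fpLogAvg(βκ) − bosonLogAvg β` whenever both halves are interval-integrable (the general splitting).
[cite: MagnenRivasseauSeneor1993, App. 1 (A.3) p.379] -/
theorem G_A3_eq_fp_sub_boson_of_integrable {β κ : ℝ}
    (h1 : IntervalIntegrable (fun θ : ℝ => Real.sin θ ^ 2 * Real.log |1 - β * κ * Real.cos θ ^ 2|) volume 0 π)
    (h2 : IntervalIntegrable (fun θ : ℝ => Real.sin θ ^ 2 * (2 * Real.log (1 - 2 * β * Real.cos (2 * θ) + β ^ 2))) volume 0 π) :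
    G_A3 β κ = fpLogAvg (β * κ) - bosonLogAvg β := by
  unfold G_A3 fpLogAvg bosonLogAvg
  have hsplit : ∀ θ : ℝ, Real.sin θ ^ 2 *
      (Real.log |1 - β * κ * Real.cos θ ^ 2| - 2 * Real.log (1 - 2 * β * Real.cos (2 * θ) + β ^ 2))
      = Real.sin θ ^ 2 * Real.log |1 - β * κ * Real.cos θ ^ 2|
        - Real.sin θ ^ 2 * (2 * Real.log (1 - 2 * β * Real.cos (2 * θ) + β ^ 2)) := by
    intro θ; ring
  simp_rw [hsplit]
  rw [intervalIntegral.integral_sub h1 h2]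
  ring

/-- Integrability of the Faddeev–Popov half for every `u = βκ ≥ 0` (continuous for `u < 1`, `intervalIntegrable_fpIntegrand` for `u ≥ 1`).
[cite: MagnenRivasseauSeneor1993, App. 1 (A.3) p.379] -/
theorem intervalIntegrable_fpIntegrand' {u : ℝ} (hu : 0 ≤ u) :
    IntervalIntegrable (fun θ : ℝ => Real.sin θ ^ 2 * Real.log |1 - u * Real.cos θ ^ 2|) volume 0 π := by
  rcases lt_or_ge u 1 with h | h
  · exact (continuous_fpIntegrand hu h).intervalIntegrable _ _
  · refine intervalIntegrable_fpIntegrand (by linarith) ?_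
    rw [abs_le]; constructor
    · have : 0 < 2 / u := by positivity
      linarith
    · rw [div_sub_one (by linarith), div_le_one (by linarith)]; linarith

/-- Integrability of the boson half for every `β ≥ 0` (continuous off `β = 1`, `intervalIntegrable_bosonIntegrand_one` at `β = 1`).
[cite: MagnenRivasseauSeneor1993, App. 1 (A.3) p.379] -/
theorem intervalIntegrable_bosonIntegrand' {β : ℝ} (hβ : 0 ≤ β) :
    IntervalIntegrable (fun θ : ℝ => Real.sin θ ^ 2 * (2 * Real.log (1 - 2 * β * Real.cos (2 * θ) + β ^ 2))) volume 0 π := by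
  rcases eq_or_ne β 1 with rfl | h
  · exact intervalIntegrable_bosonIntegrand_one 0 π
  · exact (continuous_bosonIntegrand hβ h).intervalIntegrable _ _

/-- **(A.3) = (A.4) for EVERY `β > 0`** (`0 < κ ≤ 1`): the printed three-branch closed form IS the integral, junction points and the
singular third range included (v1.1; the tree's circle/arcsine log-potential integrals supply `β = 1` and `βκ ≥ 1`).
[cite: MagnenRivasseauSeneor1993, App. 1 (A.3)–(A.4) p.379] -/
theorem G_A3_eq_G_A4 {β κ : ℝ} (hβ : 0 < β) (hκ0 : 0 < κ) (hκ1 : κ ≤ 1) : G_A3 β κ = G_A4 β κ := by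
  have hu0 : 0 < β * κ := mul_pos hβ hκ0
  have hsplit := G_A3_eq_fp_sub_boson_of_integrable (intervalIntegrable_fpIntegrand' hu0.le)
    (intervalIntegrable_bosonIntegrand' hβ.le)
  rcases lt_trichotomy β 1 with h1 | rfl | h1
  · exact G_A3_eq_G_A4_of_lt_one hβ h1 hκ0 hκ1
  · -- β = 1: first branch, `fpLogAvg κ − 4`
    unfold G_A4
    rw [if_pos le_rfl, G_A4_b1_eq, hsplit, bosonLogAvg_one, one_mul]
    rcases lt_or_eq_of_le hκ1 with hκ | rfl
    · rw [fpLogAvg_eq_fpLogClosed hκ0 hκ]; ring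
    · rw [fpLogAvg_one]; ring
  · rcases lt_trichotomy (β * κ) 1 with hu | hu | hu
    · exact G_A3_eq_G_A4_of_one_lt h1 hκ0 hu
    · -- βκ = 1: second branch (= third)
      unfold G_A4
      rw [if_neg (not_le.mpr h1), if_pos hu.le, G_A4_b2_eq hβ hκ0, hsplit, hu, fpLogAvg_one,
        bosonLogAvg_eq_of_one_lt h1]
      ring
    · -- βκ > 1: third branch
      unfold G_A4
      rw [if_neg (not_le.mpr h1), if_neg (not_le.mpr hu), G_A4_b3_eq hβ hκ0, hsplit,
        fpLogAvg_eq_fpLogClosedLarge hu.le, bosonLogAvg_eq_of_one_lt h1]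
      ring

/-- `ln 4 > 5/4` (from Mathlib's `0.6931471803 < ln 2`); used for the value `fpLogAvg 1 = 2 − 2 ln 4 ≤ −1/2`. Private helper. [folklore] -/
private theorem log_four_gt : (5 : ℝ) / 4 < Real.log 4 := by
  have h := Real.log_two_gt_d9
  rw [show (4 : ℝ) = 2 ^ 2 by norm_num, Real.log_pow]
  push_cast
  linarith

/-- The Faddeev–Popov bound `fpLogAvg u ≤ −u/2` on the CLOSED range `0 ≤ u ≤ 1` (at `u = 1`: `2 − 2 ln 4 ≤ −1/2`).
[cite: MagnenRivasseauSeneor1993, App. 1 p.379 tl.15–17] -/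
theorem fpLogAvg_le' {u : ℝ} (hu0 : 0 ≤ u) (hu1 : u ≤ 1) : fpLogAvg u ≤ -(u / 2) := by
  rcases lt_or_eq_of_le hu1 with h | rfl
  · exact fpLogAvg_le hu0 h
  · rw [fpLogAvg_one]
    unfold fpLogClosed
    have h4 := log_four_gt
    norm_num
    linarith

/-- **«for β ≤ 1 we have G(β) ≤ (−4 − κ/2)β»** on the CLOSED printed range `0 ≤ β ≤ 1` (`0 ≤ κ ≤ 1`), v1.1.
[cite: MagnenRivasseauSeneor1993, App. 1 p.379 tl.17] -/
theorem G_A3_le_slope' {β κ : ℝ} (hβ0 : 0 ≤ β) (hβ1 : β ≤ 1) (hκ0 : 0 ≤ κ) (hκ1 : κ ≤ 1) :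
    G_A3 β κ ≤ (-4 - κ / 2) * β := by
  rcases lt_or_eq_of_le hβ1 with h | rfl
  · exact G_A3_le_slope hβ0 h hκ0 hκ1
  · rw [G_A3_eq_fp_sub_boson_of_integrable (intervalIntegrable_fpIntegrand' (by positivity))
      (intervalIntegrable_bosonIntegrand' zero_le_one), bosonLogAvg_one, one_mul]
    have := fpLogAvg_le' hκ0 hκ1
    linarith

/-- **«Therefore G is always negative»** for EVERY `β > 0` (`0 ≤ κ ≤ 1`), v1.1: on `βκ ≥ 1` the closed form gives
`fpLogAvg(βκ) ≤ −2(1 + ln 4) + 2 ln β + 4`, and `2 − 2 ln 4 < 0`. [cite: MagnenRivasseauSeneor1993, App. 1 p.379 tl.16] -/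
theorem G_A3_neg' {β κ : ℝ} (hκ0 : 0 ≤ κ) (hκ1 : κ ≤ 1) (hβ0 : 0 < β) : G_A3 β κ < 0 := by
  rcases le_or_gt β 1 with h | h
  · have := G_A3_le_slope' hβ0.le h hκ0 hκ1
    nlinarith
  · have hu0 : 0 ≤ β * κ := by positivity
    rw [G_A3_eq_fp_sub_boson_of_integrable (intervalIntegrable_fpIntegrand' hu0)
      (intervalIntegrable_bosonIntegrand' hβ0.le), bosonLogAvg_eq_of_one_lt h]
    have h2 : 0 < Real.log β := Real.log_pos h
    have h3 : 0 < 4 / β := by positivity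
    rcases lt_or_ge (β * κ) 1 with hu | hu
    · have h1 := fpLogAvg_le hu0 hu
      nlinarith
    · rw [fpLogAvg_eq_fpLogClosedLarge hu]
      unfold fpLogClosedLarge
      have h4 := log_four_gt
      have hlogu : Real.log (β * κ) ≤ Real.log β := by
        apply Real.log_le_log (by linarith)
        nlinarith
      have hinv : 4 / (β * κ) ≤ 4 := by
        rw [div_le_iff₀ (by linarith)]; linarith
      nlinarith

/-- **«G′ is always negative»**, third range: on `β ≥ 1/κ` (i.e. `βκ ≥ 1`, `0 < κ ≤ 1`) `G` is STRICTLY DECREASING — there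
`G(β) = −2(1 + ln(4/κ)) − 6 ln β + 4(1 − κ)/(βκ)` with `ln` increasing and `4(1 − κ)/κ ≥ 0`. [cite: MagnenRivasseauSeneor1993, App. 1 p.379 tl.15] -/
theorem G_A3_strictAntiOn_ge_inv {κ : ℝ} (hκ0 : 0 < κ) (hκ1 : κ ≤ 1) :
    StrictAntiOn (fun β : ℝ => G_A3 β κ) {β : ℝ | 1 ≤ β * κ} := by
  intro a ha b hb hab
  simp only [Set.mem_setOf_eq] at ha hb
  simp only
  have ha0 : 0 < a := by nlinarith
  have hb0 : 0 < b := by nlinarith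
  have ha1 : 1 < a ∨ 1 = a := by
    rcases lt_or_eq_of_le (show 1 ≤ a by nlinarith) with h | h
    · exact Or.inl h
    · exact Or.inr h
  rw [G_A3_eq_G_A4 ha0 hκ0 hκ1, G_A3_eq_G_A4 hb0 hκ0 hκ1]
  -- both closed forms reduce to the third-branch expression (branches 2 and 3 agree at βκ = 1; branch 1 = branch 2 at β = 1)
  have hGa : G_A4 a κ = G_A4_b3 a κ := by
    unfold G_A4
    rcases lt_or_eq_of_le ha with hlt | heq
    · rw [if_neg (by nlinarith), if_neg (not_le.mpr hlt)]
    · -- aκ = 1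
      have hs : Real.sqrt (1 - a * κ) = 0 := by rw [← heq, sub_self, Real.sqrt_zero]
      by_cases h1 : a ≤ 1
      · have ha1' : a = 1 := le_antisymm h1 (by nlinarith)
        have hκ' : κ = 1 := by nlinarith
        subst ha1'; subst hκ'
        rw [if_pos le_rfl]
        unfold G_A4_b1 G_A4_b3
        simp
      · rw [if_neg h1, if_pos (le_of_eq heq.symm)]
        unfold G_A4_b2 G_A4_b3
        rw [hs]; simp
  have hGb : G_A4 b κ = G_A4_b3 b κ := by
    unfold G_A4
    have hbk : 1 < b * κ := by nlinarith
    rw [if_neg (by nlinarith), if_neg (not_le.mpr hbk)]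
  rw [hGa, hGb]
  unfold G_A4_b3
  have hlog : Real.log a < Real.log b := Real.log_lt_log ha0 hab
  have hinv : 4 * (1 - κ) / (b * κ) ≤ 4 * (1 - κ) / (a * κ) := by
    apply div_le_div_of_nonneg_left (by nlinarith) (by positivity)
    nlinarith
  linarith

/-! ### «G′ is always negative» as ONE statement: `G` is strictly decreasing on `[0, ∞)` -/

open Literature.Analysis.Potential in
/-- A.e. `cos²θ ≠ 1` (the countable set `πℤ`). Private helper. [folklore] -/
private theorem ae_cos_sq_ne_one : ∀ᵐ θ : ℝ, Real.cos θ ^ 2 ≠ 1 := by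
  filter_upwards [ae_cos_ne_cos 0, ae_cos_ne_cos π] with θ h0 hπ
  rw [Real.cos_zero] at h0
  rw [Real.cos_pi] at hπ
  intro h
  have hm : (Real.cos θ - 1) * (Real.cos θ + 1) = 0 := by nlinarith
  rcases mul_eq_zero.mp hm with h1 | h1
  · exact h0 (by linarith)
  · exact hπ (by linarith)

/-- The Faddeev–Popov half is antitone on the CLOSED range `0 ≤ u ≤ 1` (at `u = 1` the pointwise comparison holds off `cos²θ = 1`).
[cite: MagnenRivasseauSeneor1993, App. 1 p.379 tl.15] -/
theorem fpLogAvg_antitoneOn_Icc : AntitoneOn fpLogAvg (Icc 0 1) := by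
  intro u hu v hv huv
  rcases lt_or_eq_of_le hv.2 with hv1 | hv1
  · exact fpLogAvg_antitoneOn ⟨hu.1, lt_of_le_of_lt huv hv1⟩ ⟨hv.1, hv1⟩ huv
  · -- v = 1
    rcases lt_or_eq_of_le (hv1 ▸ huv : u ≤ 1) with hu1 | hu1
    · unfold fpLogAvg
      have hπ : 0 < 4 / π := by positivity
      apply mul_le_mul_of_nonneg_left _ hπ.le
      refine intervalIntegral.integral_mono_ae_restrict Real.pi_pos.le
        (intervalIntegrable_fpIntegrand' hv.1) (intervalIntegrable_fpIntegrand' hu.1) ?_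
      refine ae_restrict_of_ae ?_
      filter_upwards [ae_cos_sq_ne_one] with θ hθ
      have hc1 : Real.cos θ ^ 2 ≤ 1 := by
        rw [sq_le_one_iff_abs_le_one]; exact Real.abs_cos_le_one θ
      have hc1' : Real.cos θ ^ 2 < 1 := lt_of_le_of_ne hc1 hθ
      have hpv : 0 < 1 - v * Real.cos θ ^ 2 := by rw [hv1]; linarith
      have hpu : 0 < 1 - u * Real.cos θ ^ 2 := one_sub_mul_cos_sq_pos hu.1 hu1 θ
      rw [abs_of_pos hpv, abs_of_pos hpu]
      apply mul_le_mul_of_nonneg_left _ (sq_nonneg _)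
      apply Real.log_le_log hpv
      nlinarith [sq_nonneg (Real.cos θ)]
    · rw [hu1, hv1]

/-- The boson closed form `8 ln β + 4/β` is strictly increasing on `β > 1/2` (`ln(b/a) ≥ 1 − a/b`). Private helper. [folklore] -/
private theorem boson_strictMonoOn {a b : ℝ} (ha : 1 / 2 < a) (hab : a < b) :
    8 * Real.log a + 4 / a < 8 * Real.log b + 4 / b := by
  have ha0 : 0 < a := by linarith
  have hb0 : 0 < b := by linarith
  have hlog : 1 - a / b ≤ Real.log (b / a) := by
    have := Real.one_sub_inv_le_log_of_pos (show 0 < b / a by positivity)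
    rwa [inv_div] at this
  rw [Real.log_div hb0.ne' ha0.ne'] at hlog
  have h1 : 1 - a / b = (b - a) / b := by field_simp
  have h2 : 4 / b - 4 / a = -(4 * (b - a) / (a * b)) := by field_simp; ring
  have h3 : 8 * ((b - a) / b) - 4 * (b - a) / (a * b) = (b - a) / b * (8 - 4 / a) := by
    field_simp
  have h4 : 0 < 8 - 4 / a := by
    rw [sub_pos, div_lt_iff₀ ha0]; linarith
  have hba : 0 < b - a := by linarith
  have h5 : 0 < (b - a) / b * (8 - 4 / a) := by positivity
  nlinarith [hlog, h1, h2, h3, h5]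

/-- On `β ≥ 1` (`κ ≥ 0`): `G(β) = fpLogAvg(βκ) − 8 ln β − 4/β` (at `β = 1` both boson closed forms give `4`).
[cite: MagnenRivasseauSeneor1993, App. 1 (A.4) p.379] -/
theorem G_A3_eq_of_one_le {β κ : ℝ} (hβ : 1 ≤ β) (hκ0 : 0 ≤ κ) :
    G_A3 β κ = fpLogAvg (β * κ) - (8 * Real.log β + 4 / β) := by
  have hβ0 : 0 ≤ β := by linarith
  rw [G_A3_eq_fp_sub_boson_of_integrable (intervalIntegrable_fpIntegrand' (mul_nonneg hβ0 hκ0))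
    (intervalIntegrable_bosonIntegrand' hβ0)]
  rcases lt_or_eq_of_le hβ with h | h
  · rw [bosonLogAvg_eq_of_one_lt h]
  · rw [← h, bosonLogAvg_one]; simp

/-- «G′ is always negative», first range CLOSED: `G` strictly decreasing on `[0, 1]` (`0 ≤ κ ≤ 1`).
[cite: MagnenRivasseauSeneor1993, App. 1 p.379 tl.15] -/
theorem G_A3_strictAntiOn_Icc {κ : ℝ} (hκ0 : 0 ≤ κ) (hκ1 : κ ≤ 1) :
    StrictAntiOn (fun β : ℝ => G_A3 β κ) (Icc 0 1) := by
  intro a ha b hb hab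
  simp only
  rcases lt_or_eq_of_le hb.2 with hb1 | hb1
  · exact G_A3_strictAntiOn_Ico hκ0 hκ1 ⟨ha.1, by linarith⟩ ⟨hb.1, hb1⟩ hab
  · rw [hb1, G_A3_eq_of_one_le le_rfl hκ0, one_mul, Real.log_one]
    have ha1 : a < 1 := by linarith
    have hua : a * κ < 1 := by nlinarith [ha.1]
    rw [G_A3_eq_fp_sub_boson ha.1 (ne_of_lt ha1) hκ0 hua, bosonLogAvg_eq_of_lt_one ha.1 ha1]
    have hmono := fpLogAvg_antitoneOn_Icc ⟨mul_nonneg ha.1 hκ0, by nlinarith⟩ ⟨hκ0, hκ1⟩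
      (by nlinarith : a * κ ≤ κ)
    norm_num
    linarith

/-- «G′ is always negative», second range CLOSED: `G` strictly decreasing on `[1, 1/κ]` (`0 < κ`).
[cite: MagnenRivasseauSeneor1993, App. 1 p.379 tl.15] -/
theorem G_A3_strictAntiOn_Icc_one_inv {κ : ℝ} (hκ0 : 0 < κ) :
    StrictAntiOn (fun β : ℝ => G_A3 β κ) (Icc 1 (1 / κ)) := by
  intro a ha b hb hab
  simp only
  rw [G_A3_eq_of_one_le ha.1 hκ0.le, G_A3_eq_of_one_le hb.1 hκ0.le]
  have hbk : b * κ ≤ 1 := by have h := hb.2; rwa [le_div_iff₀ hκ0] at h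
  have hmono := fpLogAvg_antitoneOn_Icc ⟨by nlinarith [ha.1], by nlinarith⟩ ⟨by nlinarith [hb.1], hbk⟩
    (mul_le_mul_of_nonneg_right hab.le hκ0.le)
  have hbos := boson_strictMonoOn (by linarith [ha.1] : 1 / 2 < a) hab
  linarith

/-- **«The function G′ is always negative»** (p.379 tl.15) as one statement: for `0 < κ ≤ 1`, `β ↦ G(β)` is STRICTLY DECREASING on
`[0, ∞)` (the three printed ranges `[0, 1]`, `[1, 1/κ]`, `[1/κ, ∞)` glued at their common endpoints). Since `G(0) = 0` this also
re-proves «G is always negative». [cite: MagnenRivasseauSeneor1993, App. 1 p.379 tl.15] -/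
theorem G_A3_strictAntiOn {κ : ℝ} (hκ0 : 0 < κ) (hκ1 : κ ≤ 1) :
    StrictAntiOn (fun β : ℝ => G_A3 β κ) (Ici 0) := by
  have hk : (1 : ℝ) ≤ 1 / κ := by rw [le_div_iff₀ hκ0]; linarith
  have h12 : StrictAntiOn (fun β : ℝ => G_A3 β κ) (Icc 0 1 ∪ Icc 1 (1 / κ)) :=
    (G_A3_strictAntiOn_Icc hκ0.le hκ1).union (G_A3_strictAntiOn_Icc_one_inv hκ0)
      ⟨⟨le_rfl.trans zero_le_one, le_rfl⟩, fun x hx => hx.2⟩ ⟨⟨le_rfl, hk⟩, fun x hx => hx.1⟩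
  have h3 : StrictAntiOn (fun β : ℝ => G_A3 β κ) (Ici (1 / κ)) := by
    intro a ha b hb hab
    have ha' : 1 ≤ a * κ := by have := ha.out; rwa [div_le_iff₀ hκ0] at this
    have hb' : 1 ≤ b * κ := by have := hb.out; rwa [div_le_iff₀ hκ0] at this
    exact G_A3_strictAntiOn_ge_inv hκ0 hκ1 ha' hb' hab
  have h123 := h12.union h3 ⟨Or.inr ⟨hk, le_rfl⟩, fun x hx => by
      rcases hx with hx | hx
      · exact hx.2.trans hk
      · exact hx.2⟩ ⟨Set.self_mem_Ici, fun x hx => hx.out⟩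
  have hset : Icc 0 1 ∪ Icc 1 (1 / κ) ∪ Ici (1 / κ) = Ici (0 : ℝ) := by
    ext x
    simp only [Set.mem_union, Set.mem_Icc, Set.mem_Ici]
    constructor
    · rintro ((⟨h, _⟩ | ⟨h, _⟩) | h)
      · exact h
      · linarith
      · linarith
    · intro h
      rcases le_or_gt x 1 with h1 | h1
      · exact Or.inl (Or.inl ⟨h, h1⟩)
      · rcases le_or_gt x (1 / κ) with h2 | h2
        · exact Or.inl (Or.inr ⟨h1.le, h2⟩)
        · exact Or.inr h2.le
  rw [hset] at h123
  exact h123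

/-- `G(0) = 0`. [cite: MagnenRivasseauSeneor1993, App. 1 (A.3) p.379] -/
theorem G_A3_zero (κ : ℝ) : G_A3 0 κ = 0 := by
  unfold G_A3
  simp

end AppendixOne

end Literature.MathematicalPhysics.QuantumFieldTheory.MagnenRivasseauSeneor1993
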